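import Literature.MathematicalPhysics.QuantumFieldTheory.Balaban1983to89.Node00.Record11
import Literature.MathematicalPhysics.QuantumFieldTheory.Balaban1983to89.Node00.TkWeightsOfRecord
import Literature.MathematicalPhysics.QuantumFieldTheory.Balaban1983to89.B16Thm1BaseAtRecord11
import Literature.MathematicalPhysics.QuantumFieldTheory.Balaban1983to89.Node00.LargeFieldBackgroundMSOfRecord

/-!
# NODE 00 (YM-PLAN Track A) — STAGE 12: THE 𝐓-WEIGHTS PINNED PER RUN and THE §2 FORMAT PREDICATE REPAIRED AT ABSENT SEQUENCES —
# the Stage-11 record with (α) 11a's residual weight binder `Wt` REPLACED by the 𝐓-weights of record of FILE 12a (`tkWeightsOfRecord`, computed run by run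
# along the generated history) over a smaller residual `Zt`, with the signs `0 < cR`, `0 < A₁`; (β) the format predicate `HasSect2FormWithAE` of 11d REPLACED by
# its whole-slot dichotomy «`slot_n(s) = 0` ∨ the (2.18) identity a.e. on the `χ_n(s)`-support» under BOTH pins; (γ) witness-EXPLICIT format predicates;
# (δ) the LEVEL-0 BACKGROUND MAP OF RECORD REPAIRED to the print's `U₀(𝐖) = 𝐖 0`, so that [V] Theorem 1's induction BASE is a THEOREM at the record

Cell `pub-ymgap`, NODE 00, definer seat ₇b∕₉∕₁₀∕₁₁ (`pub-ymgap-node00-def-T`, g4; v2.3 g6), FILE 12b.  [III] = [Balaban1988Convergent], [IV] = [Balaban1989LargeFieldI],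
[I] = [Balaban1987RG1].

WHY THIS FILE.
(α) Invariant I3 of the cell (*no field an item reads may stay free*): 11d's `Stage11Params.Wt : (K : ℕ) → TkWeights … K` is read by the pins and was RESIDUAL;
FILE 12a pins it where print does ((3.16)∕(3.21)∕(3.3) [III], p. 256), as a function of the RUN (`δ_j`, `ε_j`, the cube sides depend on the history
`gOfRecord₁₀ θ p`), so the Stage-12 parameters carry only 12a's smaller residual `Zt K : TkResidualW … K` (`ζ0`, `quad`) and the weights are COMPUTED:
`WtOfRecord₁₂ θ p := tkWeightsOfRecord … p (gOfRecord₁₀ θ p) (θ.Zt p.K)`.  The located sign `0 < cR` (ref-D WATCH-11d-CR; def-R `one_mem_regSuppOfRecord`) and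
`0 < A₁` ((3.4)) enter `Admissible` as `Pos₁₂`, together with the signs `0 < C₀`, `0 < C₁` of (2.28) and `γ < 1` (see (ε) below).
(β) LOCATED MISSTATEMENT OF THE STAGE-11 PINS (dag-n13-c g0, pub-ymgap INBOX l.12128, kernel census in `B16RLeafRecord11`): def-R's (0.3) 𝐑-step `rstepOfSel`
gives the slot `0` to every sequence OFF the range of the selector `ppSel` (correctly: (0.3) [IV] re-indexed by `Z″` has no term there), and the 𝐓-step of a zero
slot is zero; but 11d's `HasSect2FormWithAE` demands the (2.18) identity a.e. on the `χ_n(s)`-support for EVERY sequence `s`, so at non-degenerate weights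
`SLaw₁₁ (k+1)` (and `TLaw₁₁ k`, `k ≥ 1`) hold only when every selector is a bijection — the «𝐑 = 1» branch.  Print's convention is that absent terms are omitted
from (2.17).  THE REPAIR, typed once and inherited by both pins: `HasSect2FormAtZ … slot t Ek :↔ UniversalE t ∧ ∀ s, law s (t s) ∧ (slot s = 0 ∨ ∀ᵐ V_n,
χ_n(s) V_n ≠ 0 → slot_n(s) V_n = sect2Slot … s (t s) (Ek s) (U s) V_n)` — «each slot of record is ABSENT (the zero function) or has the §2 form».  The
repair is on the VALUE, not on the index: `Set.range (ppSel j)` is not stable one level up (a present length-`(j+1)` sequence may extend an absent one), while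
the dichotomy captures the inductively defined set of present sequences with no new index object and no selector hypothesis; a zero term contributes nothing
to any bound on `ρ_j = Σ_s slot_j(s)`, so every ∀-consumer keeps what it needs.  11d's predicate IMPLIES the repaired one (`HasSect2FormWithAE.toZ`), and they
agree on families with no identically vanishing slot (`HasSect2FormWithAEZ.toAE`).
(δ) LOCATED MISSTATEMENT OF THE LEVEL-0 BACKGROUND (dag-n13-e g0, INBOX l.12353, kernel: `B16Thm1BaseAtRecord11` — `UbgOfRecord_zero_const`,
`not_sLaw₁₁_zero`, `not_inductionBase_datumOfRecord₁₁`; independently dag-n11-d, l.12430): r11's `Seq.Ω_off` normalises the one length-0 sequence to `Ω 0 = ∅`,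
so (2.2) read at `k = 0` gives `Γ₀ = Ω 0 = ∅` instead of the print's `Γ₀ = T`, the (2.12) constraint is empty and def-R's `UbgOfRecord … 0 s` READS NO CONFIGURATION;
the level-0 §2 slot is then constant in `V₀` and 11d's `SLaw₁₁ θ p 0` forces `ρ₀` a.e. constant — false for `N ≥ 2`, `g₀ ≠ 0`: the BASE of [V] Thm 1's printed
induction failed at every Stage-11 record with a windowed run.  THE REPAIR (n13-e's §6, adopted): `UbgOfRecord₁₂ θ p 0 := 𝐖 ↦ 𝐖 0` ([III] Thm 1: at `k = 0` there is
no sequence, `𝐓₀ = 1`, the background IS the field; print's `Γ₀ = T` pins `U₀ = V₀`), `UbgOfRecord₁₂ θ p (n+1) :=` def-R's map VERBATIM (print-faithful at positive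
length: r11's `gammaRegion_zero`, `Γ₀ = Ω₁ᶜ`).  With it `SLaw₁₂ θ p 0` is a THEOREM for every `θ`, `p` (`sLaw₁₂_zero`, from n13-e's
`hasSect2FormAE_zero_printedBackground`), hence `B16.InductionBase (datumOfRecord₁₂ θ h).C γ` for every `γ` (`inductionBase_datumOfRecord₁₂`) and [V] Theorem 1 at
the datum follows from the 𝐓-step law and the 𝐑-leaf ALONE (`thm1Printed_datumOfRecord₁₂_of_tLaw_rOpLeaf`, `thm1Printed_of_isRecordOfRecord₁₂C_of_tLaw`).  The
background proviso at level 0 is empty (`bgProviso_zero`: it quantifies `1 ≤ j ≤ 0`).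
(ε) LOCATED MISSTATEMENT OF 11d's PROVISOS (this seat, g4, kernel: `not_provisos₁₁`, `not_isRecordOfRecord₁₁C` below): 11d's field `Provisos₁₁.alphaPos :
∀ (p : B12.RunParams) (n : ℕ), 0 < α_{0}(g_n(p)) ∧ 0 < α_{1}(g_n(p))` quantifies over ALL runs, and `B12.RunParams.g0 : ℝ` is unconstrained: at the run `⟨0, 0, 0⟩`,
level `0`, `g_0 = 0` (`genSeq_zero`) and `α_{0,0}(0) = 0·C₀·(log 0⁻²)^{q₀} = 0`, so the field reads `0 < 0` — `Provisos₁₁ θ` is UNINHABITED for every `θ` and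
`IsRecordOfRecord₁₁C` is EMPTY (every family, every `N`).  Print states (2.28) [III] p. 259 — `α_{0,j} = g_j C₀ (log g_j⁻²)^{q₀}` — for couplings in the window
`]0, γ]`, where the radii ARE positive.  THE REPAIR: Stage 12 DROPS the field — radii positivity is a THEOREM in the window from the numeric signs `0 < C₀`,
`0 < C₁`, `γ < 1` now in `Pos₁₂` (`alphaPos₁₂_of_window`) — and GUARDS the one remaining run-quantified window estimate, the background proviso `bg`, by the
record's coupling window along the run, `Step.InInterval θ.γ n (gOfRecord₁₀ θ p)` (`∀ k ≤ n, 0 < g_k ∧ g_k ≤ γ`; B16's `Flow.InInterval` by `flow_g_datumOfRecord₁₂`,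
`rfl`) — the window every consumer ([V] Theorem 1 at the datum, the node items) already works in.  Consequently the Stage-11 VIEW does NOT inherit provisos
(its `Provisos₁₁` is uninhabited): the view carries parameters, setting, weights, supports and backgrounds (`rfl` faces), never a `Provisos₁₁`.
(η) LOCATED MISSTATEMENT OF THE POSITIVE-LENGTH BACKGROUND CARRIER (node00-def-R g6 LOCATED-R16, INBOX l.13178, kernel: `UbgOfRecord_eq_one_of_le_plaq`;
v2.2, director LINE №101 (α)): FILE 13's (2.12) class `regLFOfRecord` is the ONE-SCALE small-field class ([I] (1.2)), not print's SCALE-DEPENDENT space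
`U_k({Ω_j}, ε₀)` ([15] (6)∕(8) p.278), so at every length `n ≥ 1` FILE 13's `UbgOfRecord` is the junk unit configuration on the `Γ₀`-large part of the
`χ`-support and the `bg` proviso over it would be easier than print.  THE REPAIR: `UbgOfRecord₁₂ θ p (n+1) :=` def-R's `UbgMSOfRecord` (FILE 16
`Node00/LargeFieldBackgroundMSOfRecord`, the same binders letter for letter); the level-0 pin (δ) is unchanged (`UbgMSOfRecord_zero_eq_UbgOfRecord`), and the
Stage-11 view's background agrees with the Stage-12 one only on sequences without large fields at the top scale (`UbgOfRecord₁₂_succ_eq_toStage11_of_top`).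
(γ) JUNCTIONS BY NAME (NODE O P3 memo v3.33 J-11, INBOX l.12133): the format predicates are also given WITNESS-EXPLICIT (`HasSect2FormAtZ … t Ek`), so a road that
wants to constrain the witnessing term values (e.g. identify `Σ_X 𝐄^{(j)}(X, ·)` with def-B's effective-action increment `mergedTermFamilyMatT`, an [I]
(1.17)–(1.22)-level statement — NOT a definitional pin: `Sect2.TermValues.E` is the LOCALIZED family `𝐄^{(j)}(X, ·, z)`, def-B's object the TOTAL increment
`𝓝_{k+1}`) can STATE it over a named witness.  Nothing of that identification is typed here.
(ι) LOCATED MISSTATEMENT OF THE RANGE OF `SlotsNondegenerate` (node00-def-K0b g2 LOCATED-R4 «beyond the torus», INBOX l.14422 §6, kernel: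
`Record12PresentSlots` — `nonempty_seqOfRecord`, `exists_slotsOfRecord_ne_zero_of_slotsNondegenerate`; v2.3, director LINE №118, CLASS misstated, located):
v2–v2.2's `Stage12Params.SlotsNondegenerate` quantified `∀ p k s` with NO level guard, while every displayed law of the tuple stops at the torus (`Provisos₁₀`:
`intPiece` ∕ `tstep` at `k < K`, `rstep` at `k + 1 ≤ K`; `Provisos₁₂.bg` at `n ≤ p.K`; `avOfRecord_haarAC` at `k < K`) and the (2.18) index is inhabited at EVERY
`k` (the all-`∅` chain): beyond `K` the predicate demanded non-zero slots transported along `avOfRecord F N p.K k` with no `HaarAC`, through `Classical.choice`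
Radon–Nikodym versions — a junk region print never indexes ([III] (3.22) p.269 and [IV] (0.3) p.176 index the slots by the finite tower `k ≤ K`), neither
provable nor refutable as cut.  THE REPAIR (ONE def body, nothing else): the guard `k ≤ p.K →` — exactly the levels at which the tuple DISPLAYS the slot's
construction (level `0` a theorem, `slotsNondegenerate_zero`; levels `k + 1 ≤ K` by `rstep`).  The guard only WEAKENS the predicate: item texts and every
by-name consumer (the node items' bundled guard `θ.ZtUnity F N ∧ θ.SlotsNondegenerate`, the `Iff.rfl` carrier-invariance faces, K0b's
`slotsNondegenerate_iff_of_toStage9Params_eq`) are unchanged; no consumer of this file reads a slot beyond `K` (`Provisos₁₂.bg`: `n ≤ p.K`).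

WHAT IS PINNED ∕ RESIDUAL at Stage 12.  Pinned: everything pinned at Stage 11, and the 𝐓-weights up to 12a's residual (`ζ0`: the sequence-indexed resummation of
the (3.2)·(3.3) characteristic functions and gauge-fixing factors, not expressible in the `(j, Y)`-indexed signature; `quad`: [I]'s operators).  Residual: `Rz`
(11b), `Zt` (12a), and the Stage-9 residuals.  The provisos `Provisos₁₂` are 11d's with `wtLaws` REPLACED by `ztLaws : ∀ K, (Zt K).Laws` (12a PROVES 11a's
weight laws from it: `tkWeightsOfRecord_laws`), PLUS the LOCALITY LAW `ztLocal : ∀ K, (Zt K).LocalLaws` (dag-ref-D g21 (S3′), INBOX l.12854, co-signed by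
dag-ref-H g0 l.12877, director LINE №93 (1)): `ζ0 j Y ω` reads only the scale-`j` step variables `ω j` — print's `ζ_j` is a function of the scale-`j`
characteristic functions and gauge-fixing factors ((3.2)·(3.3) p.265, p.267) — which excludes the «absorbing residual» (a `ζ0` reading all scales could be
chosen to reproduce any slot and discharge the §2 pins with zero terms).  NOT a proviso, but NAMED for consumers (director LINE №92 (2) TYPING DIRECTIVE: a
statement needing the 𝐓-step law is stated under the hypothesis `hT` or over records satisfying a named `Zt`-predicate, never as a bare `∀` over
`IsRecordOfRecord₁₂C` — ref-H's (S3): `Zt = 0` is admissible and makes every §2 slot at `k ≥ 1` vanish): `Stage12Params.ZtUnity θ` = print's partition of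
unity `Σ_Y ζ0 j Y ω = 1` ((3.16)–(3.20) pp.268–269).

RELATION TO STAGE 11 (run by run, by name).  `θ.toStage11 p : Stage11Params` re-binds `Wt K := tkWeightsOfRecord … ⟨K, p.m, p.g0⟩ …`; at `K = p.K` its
weights ARE `WtOfRecord₁₂ θ p`, its setting ∕ support of record ARE the Stage-12 ones (`rfl`), its background maps at positive length live in FILE 13's
one-scale class and agree with the Stage-12 ones (print's multi-scale class, (η)) only on sequences without top-scale large fields
(`UbgOfRecord₁₂_succ_eq_toStage11_of_top`), and its `Provisos₁₁` is NOT derived (uninhabited, (ε)); no Stage-11 pin transfers to Stage 12 (v2.2).  As at every stage,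
`IsRecordOfRecord₁₂C → IsRecordOfRecord₁₁C` does NOT hold at the datum (the constructions differ in the format clause); what holds is the ₅C refinement AT THE
SHADOW with the SAME `C`, `dens`, `βfun`, `av`, and every world-reading ₅C theorem transfers (§8).

HONEST SCOPE.  Definitions of record and kernel bookkeeping (`rfl` ∕ `Iff.rfl` faces, instantiated adapters).  NOTHING of Bałaban's is asserted: Theorems 1–2
[III], (3.6)–(3.19), Prop. 1 ∕ Thm 1 [IV]∕[B16], [14]∕[15], the estimates of [I] are what would CERTIFY the pinned predicates and the provisos for the objects
of record; no node count moves (typed 28∕28 · discharged 5∕28).  RIDER №7: N-generic (`[NeZero N]`), no K0 stated here.  One finite four-torus programme at fixed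
`ε = L^{−K}` — NOT the continuum limit on ℝ⁴, NOT infinite volume, NOT OS, NOT a mass gap, NOT the Clay problem.
-/

noncomputable section

open MeasureTheory
open scoped Matrix.Norms.L2Operator

namespace Literature.MathematicalPhysics.QuantumFieldTheory.Balaban1983to89.Node00

open T4Continuum AveragingRT T4FiniteEpsInhabited FlowStep FlowStepRuns DagBinding T4DatumAssembly
open B12Eq019ActionBody (integrand)

/-! ## §1. The repaired format predicates: witness-explicit, whole-slot dichotomy (generic in `V`, `𝔸`) -/

section Sect2FormZ

open Tk

variable (F : T4Family) (N : ℕ) [NeZero N] (V : Type) [NormedAddCommGroup V] [InnerProductSpace ℝ V] [FiniteDimensional ℝ V]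
  [MeasurableSpace V] [BorelSpace V] {𝔸 : Type*} [NormedRing 𝔸] [NormedAlgebra ℂ 𝔸] [CompleteSpace 𝔸]

/-- **THE §2 FORM OF A SLOT FAMILY AT A NAMED WITNESS, ABSENT SEQUENCES ALLOWED**: term values `t s` universal in 𝐄, constants `E_n(s)`, every `t s` obeying
`law s`, and for every sequence `s` EITHER the slot is ABSENT (`slot s = 0`, the zero function — def-R's (0.3) 𝐑-step off the selector's range, the 𝐓-step of a
zero slot) OR the identity `slot_n(s) = 𝐓_n(s) exp A_n(s)` holds for `dV_n`-a.e. `V_n` on the support of `χ_n(s)`.  Print: the terms of (2.17) are indexed by the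
sequences that occur; an absent term is omitted. [cite: Balaban1988Convergent, (2.17)–(2.18) p.257, (2.21) p.258, Thm 1 p.262; Balaban1989LargeFieldI, (0.3) p.176] -/
def HasSect2FormAtZ (K : ℕ) (S : Sect2.Setting 𝔸 (SU N)) (Rz : Sect2.Residual (F.P K) 𝔸) (W : TkWeights F N V K) {ν : Stage7Numerics} {M : ℕ}
    {g : ℕ → ℝ} (n : ℕ) (U : SeqOfRecord F ν M g K n → BgMap F N K)
    (law : SeqOfRecord F ν M g K n → Sect2.TermValues (F.P K) 𝔸 V M → Prop) (slot : SeqOfRecord F ν M g K n → Density (F.P K) n (SU N))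
    (t : SeqOfRecord F ν M g K n → Sect2.TermValues (F.P K) 𝔸 V M) (Ek : SeqOfRecord F ν M g K n → ℝ) : Prop :=
  Sect2.UniversalE t ∧ ∀ s, law s (t s) ∧
    (slot s = 0 ∨
      ∀ᵐ Vn ∂(fieldMeasure (F.P K) n (SU N)), chiSeqOfRecord F N ν M g K n s Vn ≠ 0 → slot s Vn = sect2Slot F N V K S Rz W s (t s) (Ek s) (U s) Vn)

/-- **THE §2 FORM, ABSENT SEQUENCES ALLOWED** (existential witness): `∃ t Ek, HasSect2FormAtZ … slot t Ek` — 11d's `HasSect2FormWithAE` with the identity clause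
replaced by the whole-slot dichotomy. [cite: Balaban1988Convergent, (2.17)–(2.18) p.257, Thm 1 p.262] -/
def HasSect2FormWithAEZ (K : ℕ) (S : Sect2.Setting 𝔸 (SU N)) (Rz : Sect2.Residual (F.P K) 𝔸) (W : TkWeights F N V K) {ν : Stage7Numerics} {M : ℕ}
    {g : ℕ → ℝ} (n : ℕ) (U : SeqOfRecord F ν M g K n → BgMap F N K)
    (law : SeqOfRecord F ν M g K n → Sect2.TermValues (F.P K) 𝔸 V M → Prop) (slot : SeqOfRecord F ν M g K n → Density (F.P K) n (SU N)) : Prop :=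
  ∃ (t : SeqOfRecord F ν M g K n → Sect2.TermValues (F.P K) 𝔸 V M) (Ek : SeqOfRecord F ν M g K n → ℝ),
    HasSect2FormAtZ F N V K S Rz W n U law slot t Ek

/-- **THE §2 FORM AT INDEX `k`**, absent sequences allowed: laws `Sect2.LawsRT … k` on the tower of record. [cite: Balaban1988Convergent, Thm 1 p.262, (2.23) p.258] -/
def HasSect2FormAEZ (K : ℕ) (S : Sect2.Setting 𝔸 (SU N)) (Rz : Sect2.Residual (F.P K) 𝔸) (W : TkWeights F N V K) {ν : Stage7Numerics} {M : ℕ}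
    {g : ℕ → ℝ} (k : ℕ) (U : SeqOfRecord F ν M g K k → BgMap F N K) (slot : SeqOfRecord F ν M g K k → Density (F.P K) k (SU N)) : Prop :=
  HasSect2FormWithAEZ F N V K S Rz W k U (fun s t => Sect2.LawsRT (sect2TowerOfRecord F N V K S Rz s t) S.lf k) slot

/-- **THE §2 FORM OF THE 𝐓-IMAGE**, absent sequences allowed: laws `Sect2.LawsT … k` at length `k+1`. [cite: Balaban1988Convergent, §2 p.262, §3 p.279] -/
def HasSect2FormTAEZ (K : ℕ) (S : Sect2.Setting 𝔸 (SU N)) (Rz : Sect2.Residual (F.P K) 𝔸) (W : TkWeights F N V K) {ν : Stage7Numerics} {M : ℕ}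
    {g : ℕ → ℝ} (k : ℕ) (U : SeqOfRecord F ν M g K (k + 1) → BgMap F N K)
    (slotT : SeqOfRecord F ν M g K (k + 1) → Density (F.P K) (k + 1) (SU N)) : Prop :=
  HasSect2FormWithAEZ F N V K S Rz W (k + 1) U (fun s t => Sect2.LawsT (sect2TowerOfRecord F N V K S Rz s t) S.lf S.βc k) slotT

variable {F N V}

/-- **11d's PREDICATE IMPLIES THE REPAIRED ONE** (the identity branch at every sequence). [cite: Balaban1988Convergent, (2.18) p.257 (bookkeeping)] -/
theorem HasSect2FormWithAE.toZ {K : ℕ} {S : Sect2.Setting 𝔸 (SU N)} {Rz : Sect2.Residual (F.P K) 𝔸} {W : TkWeights F N V K} {ν : Stage7Numerics}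
    {M : ℕ} {g : ℕ → ℝ} {n : ℕ} {U : SeqOfRecord F ν M g K n → BgMap F N K}
    {law : SeqOfRecord F ν M g K n → Sect2.TermValues (F.P K) 𝔸 V M → Prop} {slot : SeqOfRecord F ν M g K n → Density (F.P K) n (SU N)}
    (h : HasSect2FormWithAE F N V K S Rz W n U law slot) : HasSect2FormWithAEZ F N V K S Rz W n U law slot := by
  obtain ⟨t, Ek, hu, hs⟩ := h
  exact ⟨t, Ek, hu, fun s => ⟨(hs s).1, Or.inr (hs s).2⟩⟩

/-- … at index `k`. [cite: Balaban1988Convergent, Thm 1 p.262 (bookkeeping)] -/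
theorem HasSect2FormAE.toZ {K : ℕ} {S : Sect2.Setting 𝔸 (SU N)} {Rz : Sect2.Residual (F.P K) 𝔸} {W : TkWeights F N V K} {ν : Stage7Numerics}
    {M : ℕ} {g : ℕ → ℝ} {k : ℕ} {U : SeqOfRecord F ν M g K k → BgMap F N K} {slot : SeqOfRecord F ν M g K k → Density (F.P K) k (SU N)}
    (h : HasSect2FormAE F N V K S Rz W k U slot) : HasSect2FormAEZ F N V K S Rz W k U slot :=
  HasSect2FormWithAE.toZ h

/-- … and for the 𝐓-image. [cite: Balaban1988Convergent, §2 p.262 (bookkeeping)] -/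
theorem HasSect2FormTAE.toZ {K : ℕ} {S : Sect2.Setting 𝔸 (SU N)} {Rz : Sect2.Residual (F.P K) 𝔸} {W : TkWeights F N V K} {ν : Stage7Numerics}
    {M : ℕ} {g : ℕ → ℝ} {k : ℕ} {U : SeqOfRecord F ν M g K (k + 1) → BgMap F N K}
    {slotT : SeqOfRecord F ν M g K (k + 1) → Density (F.P K) (k + 1) (SU N)} (h : HasSect2FormTAE F N V K S Rz W k U slotT) :
    HasSect2FormTAEZ F N V K S Rz W k U slotT :=
  HasSect2FormWithAE.toZ h

/-- **ON A FAMILY WITH NO ABSENT SLOT THE TWO PREDICATES AGREE**: the repaired predicate gives back 11d's. [cite: Balaban1988Convergent, (2.18) p.257 (bookkeeping)] -/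
theorem HasSect2FormWithAEZ.toAE {K : ℕ} {S : Sect2.Setting 𝔸 (SU N)} {Rz : Sect2.Residual (F.P K) 𝔸} {W : TkWeights F N V K} {ν : Stage7Numerics}
    {M : ℕ} {g : ℕ → ℝ} {n : ℕ} {U : SeqOfRecord F ν M g K n → BgMap F N K}
    {law : SeqOfRecord F ν M g K n → Sect2.TermValues (F.P K) 𝔸 V M → Prop} {slot : SeqOfRecord F ν M g K n → Density (F.P K) n (SU N)}
    (h : HasSect2FormWithAEZ F N V K S Rz W n U law slot) (hne : ∀ s, slot s ≠ 0) : HasSect2FormWithAE F N V K S Rz W n U law slot := by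
  obtain ⟨t, Ek, hu, hs⟩ := h
  exact ⟨t, Ek, hu, fun s => ⟨(hs s).1, ((hs s).2.resolve_left (hne s))⟩⟩

/-- The repaired predicate is monotone in the law package. [cite: Balaban1988Convergent, Thm 1 p.262 (bookkeeping)] -/
theorem hasSect2FormWithAEZ_mono {K : ℕ} {S : Sect2.Setting 𝔸 (SU N)} {Rz : Sect2.Residual (F.P K) 𝔸} {W : TkWeights F N V K} {ν : Stage7Numerics}
    {M : ℕ} {g : ℕ → ℝ} {n : ℕ} {U : SeqOfRecord F ν M g K n → BgMap F N K}
    {law law' : SeqOfRecord F ν M g K n → Sect2.TermValues (F.P K) 𝔸 V M → Prop} (hl : ∀ s t, law s t → law' s t)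
    {slot : SeqOfRecord F ν M g K n → Density (F.P K) n (SU N)} (h : HasSect2FormWithAEZ F N V K S Rz W n U law slot) :
    HasSect2FormWithAEZ F N V K S Rz W n U law' slot := by
  obtain ⟨t, Ek, hu, hs⟩ := h
  exact ⟨t, Ek, hu, fun s => ⟨hl s _ (hs s).1, (hs s).2⟩⟩

/-- p. 262 ∕ p. 279 on the repaired predicate: a 𝐓-image family of §2 form satisfies the inductive assumptions at index `k+1` under r11's sign conditions
(11c's `LawsT.toRT_succ`). [cite: Balaban1988Convergent, §2 p.262, §3 p.279] -/
theorem HasSect2FormTAEZ.toFormAEZ_succ {K : ℕ} {S : Sect2.Setting 𝔸 (SU N)} {Rz : Sect2.Residual (F.P K) 𝔸} {W : TkWeights F N V K} {ν : Stage7Numerics}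
    {M : ℕ} {g : ℕ → ℝ} {k : ℕ} {U : SeqOfRecord F ν M g K (k + 1) → BgMap F N K}
    {slotT : SeqOfRecord F ν M g K (k + 1) → Density (F.P K) (k + 1) (SU N)} (h : HasSect2FormTAEZ F N V K S Rz W k U slotT) (hβ : 0 ≤ S.βc)
    (hκ : 0 ≤ S.lf.κ) (hE₀ : 0 ≤ S.lf.E₀) (hB₀ : 0 ≤ S.lf.B₀) (hg : 0 ≤ S.flow.g (k + 1)) :
    HasSect2FormAEZ F N V K S Rz W (k + 1) U slotT :=
  hasSect2FormWithAEZ_mono (fun _ _ hl => hl.toRT_succ hβ hκ hE₀ hB₀ hg) h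

/-- **A.E. ON THE χ-SUPPORT A SLOT OF REPAIRED §2 FORM IS NONNEGATIVE** (absent slot: `0 ≤ 0`; present slot: 11c's `sect2Slot_nonneg` under the weight laws).
[cite: Balaban1988Convergent, (2.18) p.257, (2.21) p.258] -/
theorem HasSect2FormWithAEZ.slot_nonneg_ae {K : ℕ} {S : Sect2.Setting 𝔸 (SU N)} {Rz : Sect2.Residual (F.P K) 𝔸} {W : TkWeights F N V K} (hW : W.Laws)
    {ν : Stage7Numerics} {M : ℕ} {g : ℕ → ℝ} {n : ℕ} {U : SeqOfRecord F ν M g K n → BgMap F N K}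
    {law : SeqOfRecord F ν M g K n → Sect2.TermValues (F.P K) 𝔸 V M → Prop} {slot : SeqOfRecord F ν M g K n → Density (F.P K) n (SU N)}
    (h : HasSect2FormWithAEZ F N V K S Rz W n U law slot) (s : SeqOfRecord F ν M g K n) :
    ∀ᵐ Vn ∂(fieldMeasure (F.P K) n (SU N)), chiSeqOfRecord F N ν M g K n s Vn ≠ 0 → 0 ≤ slot s Vn := by
  obtain ⟨t, Ek, -, hs⟩ := h
  rcases (hs s).2 with h0 | hid
  · exact Filter.Eventually.of_forall fun Vn _ => by rw [h0]; exact le_rfl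
  · filter_upwards [hid] with Vn hVn hχ
    rw [hVn hχ]
    exact sect2Slot_nonneg K S Rz hW s (t s) (Ek s) (U s) Vn

/-- INHABITATION by the family of pure slots (11d's `hasSect2FormAE_zeroTerms`, through `toZ`) — consistency of the predicate; on an INDEPENDENT slot family it is
Theorem 1's content, not claimed. [cite: Balaban1988Convergent, Thm 1 p.262, (2.23) p.258; Balaban1987RG1, (0.20) p.256] -/
theorem hasSect2FormAEZ_zeroTerms (K : ℕ) (S : Sect2.Setting 𝔸 (SU N)) (Rz : Sect2.Residual (F.P K) 𝔸) (W : TkWeights F N V K) {ν : Stage7Numerics}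
    {M : ℕ} {g : ℕ → ℝ} (k : ℕ) (U : SeqOfRecord F ν M g K k → BgMap F N K) (Ek : SeqOfRecord F ν M g K k → ℝ) (hrg : S.flow.SatisfiesRG k)
    (hE₀ : 0 ≤ S.lf.E₀) (hB₀ : 0 ≤ S.lf.B₀) (hg : ∀ j, j ≤ k → 0 ≤ S.flow.g j) :
    HasSect2FormAEZ F N V K S Rz W k U (fun s => sect2Slot F N V K S Rz W s Sect2.TermValues.zero (Ek s) (U s)) :=
  (hasSect2FormAE_zeroTerms K S Rz W k U Ek hrg hE₀ hB₀ hg).toZ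

/-- **THE ABSENT FAMILY HAS THE REPAIRED FORM** (witness: zero term values, whose laws hold under the RG equations and the signs — 11c's
`lawsRT_towerOfTerms_zero`): the clause print leaves implicit. [cite: Balaban1988Convergent, (2.17) p.257; Balaban1987RG1, (0.20) p.256] -/
theorem hasSect2FormAEZ_of_forall_eq_zero (K : ℕ) (S : Sect2.Setting 𝔸 (SU N)) (Rz : Sect2.Residual (F.P K) 𝔸) (W : TkWeights F N V K) {ν : Stage7Numerics}
    {M : ℕ} {g : ℕ → ℝ} (k : ℕ) (U : SeqOfRecord F ν M g K k → BgMap F N K) {slot : SeqOfRecord F ν M g K k → Density (F.P K) k (SU N)}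
    (h0 : ∀ s, slot s = 0) (hrg : S.flow.SatisfiesRG k) (hE₀ : 0 ≤ S.lf.E₀) (hB₀ : 0 ≤ S.lf.B₀) (hg : ∀ j, j ≤ k → 0 ≤ S.flow.g j) :
    HasSect2FormAEZ F N V K S Rz W k U slot :=
  ⟨fun _ => Sect2.TermValues.zero, fun _ => 0, Sect2.universalE_const _, fun s =>
    ⟨Sect2.lawsRT_towerOfTerms_zero (V := V) S Rz M s.Ω k hrg hE₀ hB₀ hg, Or.inl (h0 s)⟩⟩

/-- **THE BOUND (2.27)(iv) BITES AT THE BACKGROUND OF RECORD** (repaired predicate; the law half is untouched by the dichotomy): under the §2 form at index `k`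
and the background proviso on `Supp`, the witnessing 𝐄-terms obey `|𝐄^{(j)}(X, U_k(𝐖), z)| ≤ E₀ exp(−κ d_j(X))` at every `𝐖 ∈ Supp s` — POINTWISE, as print.
[cite: Balaban1988Convergent, (2.23) p.258, (2.27)(iv)–(2.28) p.259] -/
theorem HasSect2FormAEZ.norm_E_bg_le {K : ℕ} {S : Sect2.Setting 𝔸 (SU N)} {Rz : Sect2.Residual (F.P K) 𝔸} {W : TkWeights F N V K} {ν : Stage7Numerics}
    {M : ℕ} {g : ℕ → ℝ} {k : ℕ} {U : SeqOfRecord F ν M g K k → BgMap F N K} {slot : SeqOfRecord F ν M g K k → Density (F.P K) k (SU N)}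
    (h : HasSect2FormAEZ F N V K S Rz W k U slot) {Supp : SeqOfRecord F ν M g K k → Set (B15DeterminingSets.MSField (F.P K) (SU N))}
    (hU : BgProviso F N K S Rz M k Supp U) :
    ∃ t : SeqOfRecord F ν M g K k → Sect2.TermValues (F.P K) 𝔸 V M, Sect2.UniversalE t ∧
      ∀ s Wc, Wc ∈ Supp s → ∀ j, 1 ≤ j → j ≤ k → ∀ (X : (Sect2.domSys (F.P K) M j).Dom) (z : Site (F.P K) j) (g' : ℝ), 0 ≤ g' → g' ≤ S.lf.γ →
        ‖(t s).E j X z g' (Sect2.ofBackgroundC S.ι (U s Wc))‖ ≤ S.lf.E₀ * Real.exp (-S.lf.κ * (Sect2.domSys (F.P K) M j).dj X) := by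
  obtain ⟨t, Ek, hu, hs⟩ := h
  refine ⟨t, hu, fun s Wc hW j h1 hj X z g' hg0 hgγ => ?_⟩
  exact (hs s).1.1.boundE j h1 hj X z g' _ hg0 hgγ (hU s Wc hW j h1 hj X).1

omit [NeZero N] in
/-- **THE BACKGROUND PROVISO AT LEVEL 0 IS EMPTY** (it quantifies the scales `1 ≤ j ≤ 0`): any support, any background map. [cite: Balaban1988Convergent, (2.28) p.259 (bookkeeping)] -/
theorem bgProviso_zero (K : ℕ) (S : Sect2.Setting 𝔸 (SU N)) (Rz : Sect2.Residual (F.P K) 𝔸) {ν : Stage7Numerics} (M : ℕ) {g : ℕ → ℝ} {n : ℕ}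
    (Supp : SeqOfRecord F ν M g K n → Set (B15DeterminingSets.MSField (F.P K) (SU N))) (U : SeqOfRecord F ν M g K n → BgMap F N K) :
    BgProviso F N K S Rz M 0 Supp U :=
  fun _ _ _ j h1 hj => absurd (le_trans h1 hj) (by decide)

end Sect2FormZ

/-! ## §2. Stage-12 parameters; the 𝐓-weights of record per run; the Stage-11 view `toStage11` -/

/-- **Stage-12 family parameters**: the Stage-9 parameters (among them the constant `A₁` of [I] (1.16) ∕ (3.4): `δ_k = g_k A₁ ∕ (A₀ p₀(g_k))`, the SAME letter
the T-step weights `wOfRecord₉` read), the §2 numerics `s2`, 11b's RESIDUAL §2 data `Rz K` and 12a's RESIDUAL part `Zt K` of the 𝐓-weights (`ζ0`, `quad`).  The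
𝐓-weights themselves are NOT parameters: they are computed run by run (`WtOfRecord₁₂`).  (Inside this declaration `F` is the inherited flow field of
`Stage1Params`; the family is `Fam`.)
[cite: Balaban1988Convergent, (2.21) p.258, (3.4) p.265, (3.16) p.268, (3.21) p.269; Balaban1987RG1, (1.12)–(1.15) p.262] -/
structure Stage12Params (Fam : T4Family) (N : ℕ) [NeZero N] extends Stage9Params Fam N where
  /-- the §2 numerics -/
  s2 : Sect2Numerics
  /-- RESIDUAL: 11b's §2 data per torus (complex background functions, smearing functions) -/
  Rz : (K : ℕ) → Sect2.Residual (Fam.P K) (MatA N)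
  /-- RESIDUAL: 12a's residual part of the 𝐓-weights per torus (`ζ0`, `quad`) -/
  Zt : (K : ℕ) → TkResidualW Fam N (FluctV N) K

variable (F : T4Family) (N : ℕ) [NeZero N]

/-- **THE STAGE-12 SIGNS**: `0 < cR` (p. 256's «O(L²)»; def-R's `one_mem_regSuppOfRecord`, ref-D WATCH-11d-CR), `0 < A₁` ((3.4): `δ_k > 0`), the signs
`0 < C₀`, `0 < C₁` of the radii (2.28), and `γ < 1` (the coupling window lies inside `]0, 1[`, where `log g⁻² > 0`) — NUMERIC clauses; no residual object is
constrained. [cite: Balaban1988Convergent, (2.10) p.256, (2.28) p.259, (3.4) p.265] -/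
def Stage12Params.Pos₁₂ (θ : Stage12Params F N) : Prop :=
  0 < θ.s2.cR ∧ 0 < θ.A₁ ∧ 0 < θ.s2.lf.C₀ ∧ 0 < θ.s2.lf.C₁ ∧ θ.γ < 1

/-- **Admissibility at Stage 12** = Stage-9 admissibility ∧ the §2 sign conditions ∧ the Stage-12 signs.  NO clause constrains a residual object.
[cite: Balaban1987RG1, (1.12) p.262; Balaban1988Convergent, (2.10) p.256, (2.34)–(2.39) p.261, (3.4) p.265 (hypothesis dictionary)] -/
def Stage12Params.Admissible (θ : Stage12Params F N) : Prop :=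
  θ.toStage9Params.Admissible ∧ θ.s2.Pos ∧ θ.Pos₁₂ F N

variable {F N} in
/-- Stage-12 admissibility refines Stage-9 admissibility. [cite: Balaban1987RG1, (0.21) p.256 (bookkeeping)] -/
theorem Stage12Params.Admissible.toStage9 {θ : Stage12Params F N} (h : θ.Admissible F N) : θ.toStage9Params.Admissible := h.1

variable {F N} in
/-- … carries the §2 sign conditions … [cite: Balaban1988Convergent, (2.34)–(2.39) p.261 (bookkeeping)] -/
theorem Stage12Params.Admissible.pos {θ : Stage12Params F N} (h : θ.Admissible F N) : θ.s2.Pos := h.2.1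

variable {F N} in
/-- … and the Stage-12 signs. [cite: Balaban1988Convergent, (2.10) p.256, (3.4) p.265 (bookkeeping)] -/
theorem Stage12Params.Admissible.pos₁₂ {θ : Stage12Params F N} (h : θ.Admissible F N) : θ.Pos₁₂ F N := h.2.2

/-- **THE 𝐓-WEIGHTS OF RECORD OF THE RUN `p`** — 12a's `tkWeightsOfRecord` at `θ`'s Stage-7 numerics, `A₁`, `cR`, along the generated history `gOfRecord₁₀ θ p`,
over the residual part `θ.Zt p.K`. [cite: Balaban1988Convergent, (2.21) p.258, (3.16) p.268, (3.21) p.269, (3.3) p.265, (2.10) p.256] -/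
def WtOfRecord₁₂ (θ : Stage12Params F N) (p : B12.RunParams) : TkWeights F N (FluctV N) p.K :=
  tkWeightsOfRecord F N (FluctV N) θ.ν θ.A₁ θ.s2.cR p (gOfRecord₁₀ F N θ.toStage9Params p) (θ.Zt p.K)

/-- **THE STAGE-11 VIEW OF `θ` FOR THE RUN `p`**: the Stage-11 parameters with the SAME Stage-9 part, numerics and §2 data, and the weight binder RE-BOUND to the
weights of record of the runs `⟨K, p.m, p.g0⟩` (at `K = p.K`: the run `p` itself). [cite: Balaban1988Convergent, (2.21) p.258 (bookkeeping)] -/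
def Stage12Params.toStage11 (θ : Stage12Params F N) (p : B12.RunParams) : Stage11Params F N where
  toStage9Params := θ.toStage9Params
  s2 := θ.s2
  Rz := θ.Rz
  Wt := fun K => WtOfRecord₁₂ F N θ ⟨K, p.m, p.g0⟩

/-- The view's weights at the run's torus ARE the weights of record of the run (`rfl`, structure eta on `B12.RunParams`). [cite: Balaban1988Convergent, (2.21) p.258 (bookkeeping)] -/
theorem Stage12Params.toStage11_Wt (θ : Stage12Params F N) (p : B12.RunParams) : (θ.toStage11 F N p).Wt p.K = WtOfRecord₁₂ F N θ p := rfl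

/-- The view's Stage-9 part IS `θ`'s (`rfl`). [cite: Balaban1987RG1, (0.21) p.256 (bookkeeping)] -/
theorem Stage12Params.toStage11_toStage9Params (θ : Stage12Params F N) (p : B12.RunParams) :
    (θ.toStage11 F N p).toStage9Params = θ.toStage9Params := rfl

variable {F N} in
/-- Stage-12 admissibility gives the view's Stage-11 admissibility. [cite: Balaban1988Convergent, (2.34)–(2.39) p.261 (bookkeeping)] -/
theorem Stage12Params.Admissible.toStage11 {θ : Stage12Params F N} (h : θ.Admissible F N) (p : B12.RunParams) : (θ.toStage11 F N p).Admissible :=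
  ⟨h.1, h.2.1⟩

variable {F N} in
/-- **11a's WEIGHT LAWS HOLD FOR THE WEIGHTS OF RECORD** under 12a's residual law (`tkWeightsOfRecord_laws`). [cite: Balaban1988Convergent, (2.21) p.258] -/
theorem WtOfRecord₁₂_laws {θ : Stage12Params F N} (hZ : ∀ K, (θ.Zt K).Laws) (p : B12.RunParams) : (WtOfRecord₁₂ F N θ p).Laws :=
  tkWeightsOfRecord_laws (hZ p.K)

/-- The term constants of record (as 11d: the numerics' `LFConsts` with the window `γ` of the record). [cite: Balaban1988Convergent, (2.27)(iii)–(2.28) p.259] -/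
def lfOfRecord₁₂ (θ : Stage12Params F N) : Step.LFConsts :=
  { θ.s2.lf with γ := θ.γ }

/-- The view's term constants ARE `lfOfRecord₁₂` (`rfl`). [cite: Balaban1988Convergent, (2.28) p.259 (bookkeeping)] -/
theorem lfOfRecord₁₁_toStage11 (θ : Stage12Params F N) (p : B12.RunParams) : lfOfRecord₁₁ F N (θ.toStage11 F N p) = lfOfRecord₁₂ F N θ := rfl

variable {F N}

/-- **(2.28): `α_{0,j} = g_j C₀ (log g_j⁻²)^{q₀} > 0` for `0 < g_j < 1`, `C₀ > 0`.** [cite: Balaban1988Convergent, (2.28) p.259] -/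
theorem alpha0_pos_of_lt_one (c : Step.LFConsts) (hC : 0 < c.C₀) {g : ℝ} (h0 : 0 < g) (h1 : g < 1) : 0 < c.alpha0 g := by
  unfold Step.LFConsts.alpha0
  have h2 : g ^ 2 < 1 := by nlinarith
  have hlog : 0 < Real.log (g ^ 2)⁻¹ := Real.log_pos ((one_lt_inv₀ (by positivity)).2 h2)
  exact mul_pos (mul_pos h0 hC) (pow_pos hlog _)

/-- **(2.28): `α_{1,j} = g_j C₁ (log g_j⁻²)^{q₁} > 0` for `0 < g_j < 1`, `C₁ > 0`.** [cite: Balaban1988Convergent, (2.28) p.259] -/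
theorem alpha1_pos_of_lt_one (c : Step.LFConsts) (hC : 0 < c.C₁) {g : ℝ} (h0 : 0 < g) (h1 : g < 1) : 0 < c.alpha1 g := by
  unfold Step.LFConsts.alpha1
  have h2 : g ^ 2 < 1 := by nlinarith
  have hlog : 0 < Real.log (g ^ 2)⁻¹ := Real.log_pos ((one_lt_inv₀ (by positivity)).2 h2)
  exact mul_pos (mul_pos h0 hC) (pow_pos hlog _)

/-- **THE RADII OF RECORD ARE POSITIVE IN THE WINDOW** (replaces 11d's uninhabitable field `alphaPos`, (ε) of the header): at an admissible Stage-12 `θ`,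
`0 < g ≤ γ` gives `0 < α_{0}(g)` and `0 < α_{1}(g)` for the term constants of record. [cite: Balaban1988Convergent, (2.28) p.259] -/
theorem alphaPos₁₂_of_window {θ : Stage12Params F N} (hθ : θ.Admissible F N) {g : ℝ} (h0 : 0 < g) (hg : g ≤ θ.γ) :
    0 < (lfOfRecord₁₂ F N θ).alpha0 g ∧ 0 < (lfOfRecord₁₂ F N θ).alpha1 g :=
  ⟨alpha0_pos_of_lt_one _ hθ.pos₁₂.2.2.1 h0 (lt_of_le_of_lt hg hθ.pos₁₂.2.2.2.2),
    alpha1_pos_of_lt_one _ hθ.pos₁₂.2.2.2.1 h0 (lt_of_le_of_lt hg hθ.pos₁₂.2.2.2.2)⟩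

/-- … along a generated history in the window `Step.InInterval θ.γ n (gOfRecord₁₀ θ p)`, at every level `j ≤ n`. [cite: Balaban1988Convergent, (2.28) p.259] -/
theorem alphaPos₁₂_of_inInterval {θ : Stage12Params F N} (hθ : θ.Admissible F N) {p : B12.RunParams} {n : ℕ}
    (hw : Step.InInterval θ.γ n (gOfRecord₁₀ F N θ.toStage9Params p)) {j : ℕ} (hj : j ≤ n) :
    0 < (lfOfRecord₁₂ F N θ).alpha0 (gOfRecord₁₀ F N θ.toStage9Params p j) ∧ 0 < (lfOfRecord₁₂ F N θ).alpha1 (gOfRecord₁₀ F N θ.toStage9Params p j) :=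
  alphaPos₁₂_of_window hθ (hw j hj).1 (hw j hj).2

variable (F N)

/-- **THE §2 SETTING OF RECORD of the run `p`** (as 11d: the `SU(N)` model pinned, the §2 numerics, the term constants of record, the flow of the run along
`gOfRecord₁₀`). [cite: Balaban1987RG1, pp.251–252, (1.12) p.262, (0.20) p.256; Balaban1988Convergent, (2.28) p.259, (2.34)–(2.39) p.261] -/
def settingOfRecord₁₂ (θ : Stage12Params F N) (p : B12.RunParams) : Sect2.Setting (MatA N) (SU N) where
  𝓜 := B12RegularSpaces111SpecialUnitary.suModel N
  ι := ιSU N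
  cB := θ.s2.cB
  βc := θ.s2.βc
  B := θ.s2.B
  C := θ.s2.C
  Mr := θ.s2.Mr
  lf := lfOfRecord₁₂ F N θ
  flow := flowOfRun (gOfRecord₁₀ F N θ.toStage9Params p)

/-- The view's setting of record at ANY view-run IS the Stage-12 setting (`rfl`: the setting does not read the weights). [cite: Balaban1988Convergent, (2.28) p.259 (bookkeeping)] -/
theorem settingOfRecord₁₁_toStage11 (θ : Stage12Params F N) (p p' : B12.RunParams) :
    settingOfRecord₁₁ F N (θ.toStage11 F N p') p = settingOfRecord₁₂ F N θ p := rfl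

/-- 11b's model provisos discharged by construction (11d's `settingOfRecord₁₁_laws`). [cite: Balaban1987RG1, pp.251–252, (1.10)–(1.11) p.262] -/
theorem settingOfRecord₁₂_laws (θ : Stage12Params F N) (p : B12.RunParams) : (settingOfRecord₁₂ F N θ p).Laws :=
  settingOfRecord₁₁_laws F N (θ.toStage11 F N p) p

/-- The setting's sign conditions ARE the numerics'. [cite: Balaban1988Convergent, (2.34)–(2.39) p.261 (bookkeeping)] -/
theorem settingOfRecord₁₂_pos (θ : Stage12Params F N) (hθ : θ.s2.Pos) (p : B12.RunParams) : (settingOfRecord₁₂ F N θ p).Pos :=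
  settingOfRecord₁₁_pos F N (θ.toStage11 F N p) hθ p

/-- The setting's flow satisfies the RG equations at every index. [cite: Balaban1987RG1, (0.20) p.256] -/
theorem settingOfRecord₁₂_satisfiesRG (θ : Stage12Params F N) (p : B12.RunParams) (k : ℕ) : (settingOfRecord₁₂ F N θ p).flow.SatisfiesRG k :=
  flowOfRun_satisfiesRG _ k

/-- The setting's couplings ARE the generated history (`rfl`). [cite: Balaban1987RG1, (0.17)–(0.20) pp.255–256 (bookkeeping)] -/
theorem settingOfRecord₁₂_flow_g (θ : Stage12Params F N) (p : B12.RunParams) :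
    (settingOfRecord₁₂ F N θ p).flow.g = gOfRecord₁₀ F N θ.toStage9Params p := rfl

/-- **THE BACKGROUND MAPS OF RECORD** of the run `p` at length `n`, LEVEL 0 REPAIRED: at `n = 0` the PRINT's background `U₀(𝐖) := 𝐖 0` — [III] Thm 1 p. 262:
at `k = 0` there is no sequence, `𝐓₀ = 1`, (2.2) gives `Γ₀ = T` and the (2.12) constraint pins `U₀ = V₀` (r11's `Seq.Ω_off` normalises a length-0 sequence to
`Ω 0 = ∅`, so def-R's `UbgOfRecord … 0 s` reads no configuration — `B16Thm1BaseAtRecord11.UbgOfRecord_zero_const`, the located base defect of Stage 11); at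
`n + 1` def-R's background map IN PRINT'S MULTI-SCALE CLASS `U_k({Ω_j}, ε₀)` — `UbgMSOfRecord` (FILE 16 `Node00/LargeFieldBackgroundMSOfRecord`, letter-for-letter
the binders of FILE 13's `UbgOfRecord`; v2.2, def-R's LOCATED-R16: FILE 13's ONE-SCALE class `regLFOfRecord` makes the positive-length background the junk unit
configuration on the `Γ₀`-large part — `UbgOfRecord_eq_one_of_le_plaq` — so the `bg` proviso over it would be easier than print; director LINE №101 (α)).  The two
carriers AGREE at length 0 (`UbgMSOfRecord_zero_eq_UbgOfRecord`) and on sequences without large fields at the top scale (`UbgMSOfRecord_eq_UbgOfRecord_of_top`).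
[cite: Balaban1988Convergent, Thm 1 p.262, (2.2) p.255, (2.12)–(2.13) pp.256–257, §2 p.258; Balaban1985AveragingOps, (6)∕(8) p.278] -/
def UbgOfRecord₁₂ (θ : Stage12Params F N) (p : B12.RunParams) :
    (n : ℕ) → (SeqOfRecord F θ.ν θ.τ9.M (gOfRecord₁₀ F N θ.toStage9Params p) p.K n → BgMap F N p.K)
  | 0 => fun _ W => W 0
  | n + 1 => UbgMSOfRecord F N θ.ν θ.τ9.M (gOfRecord₁₀ F N θ.toStage9Params p) p.K (n + 1)

/-- LEVEL 0: the background map of record IS the scale-0 field (`rfl`). [cite: Balaban1988Convergent, Thm 1 p.262] -/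
theorem UbgOfRecord₁₂_zero (θ : Stage12Params F N) (p : B12.RunParams) : UbgOfRecord₁₂ F N θ p 0 = fun _ W => W 0 := rfl

/-- LEVEL `n + 1`: def-R's background map of record in print's multi-scale class (`rfl`). [cite: Balaban1988Convergent, (2.12)–(2.13) pp.256–257] -/
theorem UbgOfRecord₁₂_succ (θ : Stage12Params F N) (p : B12.RunParams) (n : ℕ) :
    UbgOfRecord₁₂ F N θ p (n + 1) = UbgMSOfRecord F N θ.ν θ.τ9.M (gOfRecord₁₀ F N θ.toStage9Params p) p.K (n + 1) := rfl

/-- **THE SUPPORT OF RECORD** of the background proviso — def-R's `regSuppOfRecord` at the letter `cR` (as 11d). [cite: Balaban1988Convergent, (2.10) p.256, (2.28) p.259] -/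
def suppOfRecord₁₂ (θ : Stage12Params F N) (p : B12.RunParams) (n : ℕ) :
    SeqOfRecord F θ.ν θ.τ9.M (gOfRecord₁₀ F N θ.toStage9Params p) p.K n → Set (B15DeterminingSets.MSField (F.P p.K) (SU N)) :=
  regSuppOfRecord F N θ.ν θ.τ9.M (gOfRecord₁₀ F N θ.toStage9Params p) p.K n θ.s2.cR

/-- The view's background maps (11d, FILE 13's one-scale class) AGREE with the Stage-12 ones at positive length on every sequence WITHOUT large fields at the
top scale (`Ω_{n+1} = T`); in general they differ (v2.2: the Stage-12 background lives in print's multi-scale class), and at length 0 they differ by the repair (δ).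
[cite: Balaban1988Convergent, (2.12)–(2.13) pp.256–257 (bookkeeping); Balaban1985AveragingOps, (6)∕(8) p.278] -/
theorem UbgOfRecord₁₂_succ_eq_toStage11_of_top (θ : Stage12Params F N) (hε : 0 ≤ θ.ν.εreg) (p p' : B12.RunParams) (n : ℕ)
    (s : SeqOfRecord F θ.ν θ.τ9.M (gOfRecord₁₀ F N θ.toStage9Params p) p.K (n + 1)) (hs : s.Ω (n + 1) = Set.univ) :
    UbgOfRecord₁₂ F N θ p (n + 1) s = UbgOfRecord₁₁ F N (θ.toStage11 F N p') p (n + 1) s := by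
  show UbgMSOfRecord F N θ.ν θ.τ9.M (gOfRecord₁₀ F N θ.toStage9Params p) p.K (n + 1) s =
    UbgOfRecord F N θ.ν θ.τ9.M (gOfRecord₁₀ F N θ.toStage9Params p) p.K (n + 1) s
  rw [UbgMSOfRecord_eq_UbgOfRecord_of_top θ.ν hε θ.τ9.M (gOfRecord₁₀ F N θ.toStage9Params p) p.K s hs]

/-- The view's support of record IS the Stage-12 one (`rfl`). [cite: Balaban1988Convergent, (2.10) p.256 (bookkeeping)] -/
theorem suppOfRecord₁₁_toStage11 (θ : Stage12Params F N) (p p' : B12.RunParams) (n : ℕ) :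
    suppOfRecord₁₁ F N (θ.toStage11 F N p') p n = suppOfRecord₁₂ F N θ p n := rfl

/-- **THE REGULAR SUPPORT CONTAINS THE UNIT CONFIGURATION at an admissible Stage-12 θ** whenever the radii `ε_j` are positive (def-R's `one_mem_regSuppOfRecord` at
`0 < cR`): the support of record is non-empty — the located `cR` corner of Stage 11 is closed by `Pos₁₂`. [cite: Balaban1988Convergent, (2.10) p.256] -/
theorem one_mem_suppOfRecord₁₂ (θ : Stage12Params F N) (hθ : θ.Pos₁₂ F N) (p : B12.RunParams) (n : ℕ)
    (hε : ∀ j ≤ n, 0 < epsOfRecord θ.ν (gOfRecord₁₀ F N θ.toStage9Params p) j)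
    (s : SeqOfRecord F θ.ν θ.τ9.M (gOfRecord₁₀ F N θ.toStage9Params p) p.K n) :
    (1 : B15DeterminingSets.MSField (F.P p.K) (SU N)) ∈ suppOfRecord₁₂ F N θ p n s :=
  one_mem_regSuppOfRecord F N θ.ν θ.τ9.M (gOfRecord₁₀ F N θ.toStage9Params p) p.K n hθ.1 hε s

/-! ## §3. THE TWO PINS, REPAIRED: `S218OfRecord₁₂`, `ScorrLawOfRecord₁₂`; the carriers, the residual, the view, the core -/

/-- **THE §2 [III] FORMAT PREDICATE OF RECORD, STAGE 12** for step-`j` densities of the run `p`: `σ` IS REPRESENTED by `rep_j` of record AND the post-𝐑 slot family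
of record has the REPAIRED §2 form at index `j` (`HasSect2FormAEZ`: each slot absent or `= 𝐓_j(s) exp A_j(s)` a.e. on the χ-support, law-abiding universal terms)
— at the setting of record, the residual §2 data of `θ`, THE 𝐓-WEIGHTS OF RECORD OF THE RUN, and def-R's background maps of record.
[cite: Balaban1988Convergent, (2.17)–(2.18) p.257, (2.23)–(2.42) pp.258–261, Thm 1 p.262] -/
def S218OfRecord₁₂ (θ : Stage12Params F N) (p : B12.RunParams) (j : ℕ) (σ : Density (F.P p.K) j (SU N)) : Prop :=
  (reprOfRecord₁₀ F N θ.toStage9Params p j).Holds σ ∧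
    HasSect2FormAEZ F N (FluctV N) p.K (settingOfRecord₁₂ F N θ p) (θ.Rz p.K) (WtOfRecord₁₂ F N θ p) j
      (UbgOfRecord₁₂ F N θ p j)
      (slotsOfRecord F N θ.ν θ.τ9 (EOfRecord₁₀ F N θ.toStage9Params) (wOfRecord₉ F N θ.toStage9Params) θ.ppSel p
        (gOfRecord₁₀ F N θ.toStage9Params p) j)

/-- **THE «CORRESPONDING SPACE» PREDICATE OF RECORD, STAGE 12** for the 𝐓-image at step `k+1`: represented by `Tstep rep_k` of record AND the pre-𝐑 slot family of
record at level `k+1` has the REPAIRED 𝐓-image form (`HasSect2FormTAEZ`). [cite: Balaban1988Convergent, remark p.262, Def. p.279, (3.25) p.270] -/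
def ScorrLawOfRecord₁₂ (θ : Stage12Params F N) (p : B12.RunParams) (k : ℕ) (σ' : Density (F.P p.K) (k + 1) (SU N)) : Prop :=
  (reprTOfRecord₁₀ F N θ.toStage9Params p k).Holds σ' ∧
    HasSect2FormTAEZ F N (FluctV N) p.K (settingOfRecord₁₂ F N θ p) (θ.Rz p.K) (WtOfRecord₁₂ F N θ p) k
      (UbgOfRecord₁₂ F N θ p (k + 1))
      (slotsTOfRecord F N θ.ν θ.τ9 (EOfRecord₁₀ F N θ.toStage9Params) (wOfRecord₉ F N θ.toStage9Params) θ.ppSel p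
        (gOfRecord₁₀ F N θ.toStage9Params p) (k + 1))

/-- **`SLaw₁₂ θ p j`** — the repaired §2 format law of `ρ_j` OF RECORD: `S218OfRecord₁₂` READ AT `densOfRecord₁₀`. [cite: Balaban1988Convergent, (2.18) p.257, Thm 1 p.262] -/
def SLaw₁₂ (θ : Stage12Params F N) (p : B12.RunParams) (j : ℕ) : Prop :=
  S218OfRecord₁₂ F N θ p j (densOfRecord₁₀ F N θ.toStage9Params p j)

/-- **`TLaw₁₂ θ p k`** — the repaired «corresponding space» law of `𝐓ρ_k` OF RECORD: `ScorrLawOfRecord₁₂` READ AT `tdensOfRecord₁₀`. [cite: Balaban1988Convergent, remark p.262, Def. p.279] -/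
def TLaw₁₂ (θ : Stage12Params F N) (p : B12.RunParams) (k : ℕ) : Prop :=
  ScorrLawOfRecord₁₂ F N θ p k (tdensOfRecord₁₀ F N θ.toStage9Params p k)

/-- `SLaw₁₂` IS the repaired §2 form of the post-𝐑 slot family (the representation clause holds by construction). [cite: Balaban1988Convergent, (2.18) p.257, Thm 1 p.262] -/
theorem sLaw₁₂_iff (θ : Stage12Params F N) (p : B12.RunParams) (j : ℕ) :
    SLaw₁₂ F N θ p j ↔ HasSect2FormAEZ F N (FluctV N) p.K (settingOfRecord₁₂ F N θ p) (θ.Rz p.K) (WtOfRecord₁₂ F N θ p) j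
      (UbgOfRecord₁₂ F N θ p j)
      (slotsOfRecord F N θ.ν θ.τ9 (EOfRecord₁₀ F N θ.toStage9Params) (wOfRecord₉ F N θ.toStage9Params) θ.ppSel p
        (gOfRecord₁₀ F N θ.toStage9Params p) j) :=
  ⟨fun h => h.2, fun h => ⟨holds_densOfRecord₁₀ F N θ.toStage9Params p j, h⟩⟩

/-- `TLaw₁₂` IS the repaired 𝐓-image form of the pre-𝐑 slot family. [cite: Balaban1988Convergent, remark p.262, (3.25) p.270] -/
theorem tLaw₁₂_iff (θ : Stage12Params F N) (p : B12.RunParams) (k : ℕ) :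
    TLaw₁₂ F N θ p k ↔ HasSect2FormTAEZ F N (FluctV N) p.K (settingOfRecord₁₂ F N θ p) (θ.Rz p.K) (WtOfRecord₁₂ F N θ p) k
      (UbgOfRecord₁₂ F N θ p (k + 1))
      (slotsTOfRecord F N θ.ν θ.τ9 (EOfRecord₁₀ F N θ.toStage9Params) (wOfRecord₉ F N θ.toStage9Params) θ.ppSel p
        (gOfRecord₁₀ F N θ.toStage9Params p) (k + 1)) :=
  ⟨fun h => h.2, fun h => ⟨holds_tdensOfRecord₁₀ F N θ.toStage9Params p k, h⟩⟩

/-- **THE BASE IS A THEOREM**: the post-𝐑 slot family of record at level 0 (= `ρ₀` on the one length-0 sequence) HAS the repaired §2 form at index 0 for EVERY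
`θ` and run — n13-e's `hasSect2FormAE_zero_printedBackground` (zero terms, `E_0 = E` of the run, identity at every `V₀` under the print's `U₀`), identity branch.
[cite: Balaban1988Convergent, Thm 1 p.262, (2.18) p.257, (2.23)–(2.24) pp.258–259] -/
theorem sLaw₁₂_zero (θ : Stage12Params F N) (p : B12.RunParams) : SLaw₁₂ F N θ p 0 :=
  (sLaw₁₂_iff F N θ p 0).mpr (B16Thm1BaseAtRecord11.hasSect2FormAE_zero_printedBackground F N (θ.toStage11 F N p) p).toZ

/-- … so at level 0 the format predicate of record IS the representation clause. [cite: Balaban1988Convergent, Thm 1 p.262, (2.18) p.257 (bookkeeping)] -/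
theorem s218OfRecord₁₂_zero_iff (θ : Stage12Params F N) (p : B12.RunParams) (σ : Density (F.P p.K) 0 (SU N)) :
    S218OfRecord₁₂ F N θ p 0 σ ↔ (reprOfRecord₁₀ F N θ.toStage9Params p 0).Holds σ :=
  ⟨fun h => h.1, fun h => ⟨h, (sLaw₁₂_zero F N θ p).2⟩⟩

/-! (v2.2) The four Stage-11-view transfer lemmas of v2∕v2.1 (`s218OfRecord₁₂_of_stage11`, `scorrLawOfRecord₁₂_of_stage11`, `sLaw₁₂_of_stage11`,
`tLaw₁₂_of_stage11`) held only by the `rfl` identity of the positive-length background carriers; after the re-point (η) the Stage-11 view keeps FILE 13's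
one-scale class while Stage 12 reads print's multi-scale class, so the blanket transfer is no longer a theorem (0 users outside this file; node00-def-R g6
PRECHECK-α, dag-ref-D g21 R16 ADDENDUM) — REMOVED.  The pointwise agreement on sequences without top-scale large fields is `UbgOfRecord₁₂_succ_eq_toStage11_of_top`. -/

/-- **ABSENT SLOTS PASS**: if every post-𝐑 slot of record at level `j` is the zero function, `SLaw₁₂ θ p j` holds under the signs `0 ≤ E₀, B₀` and a nonnegative
history up to `j` (the RG equations hold for the flow of the run) — the clause the Stage-11 pin got wrong. [cite: Balaban1988Convergent, (2.17) p.257; Balaban1987RG1, (0.20) p.256] -/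
theorem sLaw₁₂_of_forall_slot_eq_zero (θ : Stage12Params F N) (p : B12.RunParams) (j : ℕ)
    (h0 : ∀ s, slotsOfRecord F N θ.ν θ.τ9 (EOfRecord₁₀ F N θ.toStage9Params) (wOfRecord₉ F N θ.toStage9Params) θ.ppSel p
      (gOfRecord₁₀ F N θ.toStage9Params p) j s = 0)
    (hE₀ : 0 ≤ θ.s2.lf.E₀) (hB₀ : 0 ≤ θ.s2.lf.B₀) (hg : ∀ i, i ≤ j → 0 ≤ gOfRecord₁₀ F N θ.toStage9Params p i) : SLaw₁₂ F N θ p j :=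
  (sLaw₁₂_iff F N θ p j).mpr
    (hasSect2FormAEZ_of_forall_eq_zero p.K _ _ _ j _ h0 (settingOfRecord₁₂_satisfiesRG F N θ p j) hE₀ hB₀ hg)

/-- **THE 𝐑-CARRIERS OF THE RUN `p`, STAGE 12**: as `VOfRecord₁₁` with the repaired laws — target space `S j ρ :↔ ρ = ρ_j ∧ SLaw₁₂ θ p j`, corresponding space
`Scorr (k+1) ρ' :↔ ρ' = 𝐓ρ_k ∧ TLaw₁₂ θ p k`, `Scorr 0 :≡ ⊥`. [cite: Balaban1988Convergent, p.244 and remark p.262; Balaban1989LargeFieldI, (0.2)–(0.3) p.176] -/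
def VOfRecord₁₂ (θ : Stage12Params F N) (p : B12.RunParams) : PrintedCarriers14R where
  P := F.P p.K
  G := SU N
  instGG := inferInstance
  instMS := inferInstance
  instHD := inferInstance
  K := p.K
  R := fun k => inducedAt (tdensOfRecord₁₀ F N θ.toStage9Params p k) (densOfRecord₁₀ F N θ.toStage9Params p (k + 1))
  Scorr := fun j ρ' => match j with
    | 0 => False
    | k + 1 => ρ' = tdensOfRecord₁₀ F N θ.toStage9Params p k ∧ TLaw₁₂ F N θ p k
  S := fun j ρ => ρ = densOfRecord₁₀ F N θ.toStage9Params p j ∧ SLaw₁₂ F N θ p j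

/-- The pinned density operation maps `𝐓ρ_k ↦ ρ_{k+1}`. [cite: Balaban1989LargeFieldI, (0.2)–(0.3) p.176 (bookkeeping)] -/
theorem R_VOfRecord₁₂_tdens (θ : Stage12Params F N) (p : B12.RunParams) (k : ℕ) :
    (VOfRecord₁₂ F N θ p).R k (tdensOfRecord₁₀ F N θ.toStage9Params p k) = densOfRecord₁₀ F N θ.toStage9Params p (k + 1) :=
  inducedAt_self _ _

/-- **[III] p. 244's LEAF AT THE STAGE-12 CARRIERS**: `ROpLeaf (VOfRecord₁₂ θ p) ↔ ∀ k < K, TLaw₁₂ θ p k → SLaw₁₂ θ p (k+1)` — Theorem 2's shape at the objects of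
record, now contentful at every `k` (absent sequences pass on both sides). [cite: Balaban1988Convergent, p.244, Thm 2 p.263 and remark p.262 (bookkeeping)] -/
theorem rOpLeaf_VOfRecord₁₂_iff (θ : Stage12Params F N) (p : B12.RunParams) :
    ROpLeaf (VOfRecord₁₂ F N θ p) ↔ ∀ k, k < p.K → TLaw₁₂ F N θ p k → SLaw₁₂ F N θ p (k + 1) := by
  rw [rOpLeaf_iff]
  refine ⟨fun h k hk hT => ?_, fun h k hk ρ' hρ' => ?_⟩
  · have hS := h k hk (tdensOfRecord₁₀ F N θ.toStage9Params p k) ⟨rfl, hT⟩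
    rw [R_VOfRecord₁₂_tdens] at hS
    exact hS.2
  · obtain ⟨rfl, hT⟩ := hρ'
    show (VOfRecord₁₂ F N θ p).S (k + 1) ((VOfRecord₁₂ F N θ p).R k (tdensOfRecord₁₀ F N θ.toStage9Params p k))
    rw [R_VOfRecord₁₂_tdens]
    exact ⟨rfl, h k hk hT⟩

/-- **THE STAGE-12 RESIDUAL**: the Stage-10 residual with `V := VOfRecord₁₂ θ` and `S218 := S218OfRecord₁₂ θ` PINNED. [cite: Balaban1988Convergent, p.244, (2.18) p.257; Balaban1989LargeFieldI, (0.2)–(0.6) pp.176–177 (dictionary; bookkeeping)] -/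
def residualOfStage12 (θ : Stage12Params F N) : Residual₅ F N :=
  { residualOfStage10 F N θ.toStage9Params with
    V := VOfRecord₁₂ F N θ
    S218 := S218OfRecord₁₂ F N θ }

/-- **The Stage-5 VIEW of Stage-12 parameters**. [cite: Balaban1989LargeFieldII, Thm 1 p.355 (bookkeeping)] -/
def Stage12Params.toStage5₁₂ (θ : Stage12Params F N) : Stage5Params F N :=
  { θ.toStage5Params with res := residualOfStage12 F N θ }

/-- The view's 𝐑-carriers ARE the pinned ones (`rfl`). [cite: Balaban1988Convergent, p.244 (bookkeeping)] -/
theorem Stage12Params.toStage5₁₂_res_V (θ : Stage12Params F N) (p : B12.RunParams) : (θ.toStage5₁₂ F N).res.V p = VOfRecord₁₂ F N θ p := rfl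

/-- The view's format slot IS the Stage-12 predicate of record (`rfl`). [cite: Balaban1988Convergent, (2.18) p.257 (bookkeeping)] -/
theorem Stage12Params.toStage5₁₂_res_S218 (θ : Stage12Params F N) : (θ.toStage5₁₂ F N).res.S218 = S218OfRecord₁₂ F N θ := rfl

/-- **THE RECORD'S 𝐑-LEAF, UNFOLDED** at the C-binding of record over the Stage-12 view. [cite: Balaban1988Convergent, p.244 and Thm 2 p.263; Balaban1989LargeFieldII, Thm 1 p.355 (bookkeeping)] -/
theorem rOperation_upOfRecord₅C_stage12_iff (θ : Stage12Params F N) (p : B12.RunParams) :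
    (upOfRecord₅C F N (θ.toStage5₁₂ F N) p).rOperation ↔ ∀ k, k < p.K → TLaw₁₂ F N θ p k → SLaw₁₂ F N θ p (k + 1) := by
  show ROpLeaf (VOfRecord₁₂ F N θ p) ↔ _
  exact rOpLeaf_VOfRecord₁₂_iff F N θ p

/-- **THE CORE OF RECORD at `θ`**: the Stage-10 core of the Stage-9 part with `Sect2Form p k := S218OfRecord₁₂ θ p k ρ_k`. [cite: Balaban1987RG1, (0.17)–(0.24) pp.255–257; Balaban1988Convergent, (2.17)–(2.18) p.257, Thm 1 p.262 (dictionary; bookkeeping)] -/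
def coreOfRecord₁₂ (θ : Stage12Params F N) : RGMachineCore F (SU N) :=
  { coreOfRecord₁₀ F N θ.toStage9Params with
    Sect2Form := fun p k => S218OfRecord₁₂ F N θ p k (densOfRecord₁₀ F N θ.toStage9Params p k) }

/-- The core's Wilson start IS `ρ₀` of record. [cite: Balaban1988Convergent, Thm 1 p.262 (bookkeeping)] -/
theorem rhoZero_coreOfRecord₁₂ (θ : Stage12Params F N) (p : B12.RunParams) :
    (coreOfRecord₁₂ F N θ).rhoZero p = densOfRecord₁₀ F N θ.toStage9Params p 0 :=
  rhoZero_coreOfRecord₁₀ F N θ.toStage9Params p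

/-- The core's §2 clause IS `SLaw₁₂` (`Iff.rfl`). [cite: Balaban1988Convergent, (2.18) p.257, Thm 1 p.262 (bookkeeping)] -/
theorem sect2Form_coreOfRecord₁₂_iff (θ : Stage12Params F N) (p : B12.RunParams) (k : ℕ) :
    (coreOfRecord₁₂ F N θ).Sect2Form p k ↔ SLaw₁₂ F N θ p k := Iff.rfl

/-! ## §4. The displayed provisos of the Stage-12 record -/

/-- **`Provisos₁₁` IS UNINHABITED** ((ε) of the header): 11d's field `alphaPos` at the run `⟨0, 0, 0⟩`, level `0`, reads `0 < α_{0,0}(0) = 0`.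
[cite: Balaban1988Convergent, (2.28) p.259 (bookkeeping: the typed hypothesis, not print)] -/
theorem not_provisos₁₁ (θ : Stage11Params F N) : ¬ θ.Provisos₁₁ F N := by
  intro h
  have h1 := (h.alphaPos ⟨0, 0, 0⟩ 0).1
  have hg : gOfRecord₁₀ F N θ.toStage9Params ⟨0, 0, 0⟩ 0 = 0 := FlowStepRuns.genSeq_zero _ _
  rw [hg] at h1
  simp [Step.LFConsts.alpha0] at h1

/-- **… hence NO Stage-11 record exists**: `IsRecordOfRecord₁₁C F N D w` is false for every `D`, `w` (every family, every `N`) — the reason Stage 12 drops the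
field and guards `bg` ((ε)). [cite: Balaban1988Convergent, (2.28) p.259 (bookkeeping: the typed hypothesis, not print)] -/
theorem not_isRecordOfRecord₁₁C (D : FiniteEpsData F (SU N)) (w : WorldP) : ¬ IsRecordOfRecord₁₁C F N D w :=
  fun ⟨θ, h, _⟩ => not_provisos₁₁ F N θ h

variable {F N} in
/-- **THE LOCALITY LAW OF THE RESIDUAL 𝐓-WEIGHT FACTOR — PRINT'S TWO-SCALE FORM** (v-R2b, FLAG №1 N11 cure, plan g91 road of record 2026-08-29; originally dag-ref-D g21
(S3′) in the ONE-SCALE form `ω j = ω' j → …`, located STRONGER than print by dag-n11-d g19∕g31): `ζ0 j Y` reads the scale-`j` step variables AND the scale-`(j+1)` GAUGE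
variables — `ω j = ω' j → (ω (j+1)).1 = (ω' (j+1)).1 → ζ0 j Y ω = ζ0 j Y ω'`.  Print's `ζ(Ω^c_{k+1})` (p.267) is the resummation of the (3.2) characteristic functions OF THE
NEW FIELD `V_{k+1}` (p.264 bottom «the new fields V_{k+1} … We introduce new restrictions on these fields») and the (3.3)∕(3.4) functions of `V_k` against `M^k(U_{k+1,□})`, plus
gauge-fixing factors, all localized in `Ω_k ∖ Ω_{k+1}`; in 11a's indexing the new field during generation `j` is `(ω (j+1)).1` (`Tk.vOp`).  It still excludes the «absorbing
residual» junk discharge of the §2 pins (no dependence on scales `< j`, on `A_{j+1}`, or on scales `≥ j+2`).  `LocalLaws₂` of `Record12LocalLawsTwoScale` (p692453) is the same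
law stated beside this one before the cure; after it the two coincide.  EDITION (director-ym №272 (2) «(b′) YES OF RECORD», W2 ∕ R495-ym, T1′; dag-n11-d g31 RUNBOOK (A)
verbatim; ref-K g24 READ-451 LOCATED-7∕7): the field `zeta0_local` WEAKENED from the one-scale to print's two-scale form; name kept; nothing else in this file reads it.
[cite: Balaban1988Convergent, (3.1) p.264, (3.2)–(3.4) p.265, p.267] -/
structure TkResidualW.LocalLaws {V : Type} {K : ℕ} (Z : TkResidualW F N V K) : Prop where
  /-- `ζ0` at generation `j` is a function of the scale-`j` configuration and the scale-`(j+1)` gauge variables only -/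
  zeta0_local : ∀ (j : ℕ) (Y : Set (Site (F.P K) 0)) (ω ω' : Tk.MultiCfg (F.P K) (SU N) V),
    ω j = ω' j → (ω (j + 1)).1 = (ω' (j + 1)).1 → Z.ζ0 j Y ω = Z.ζ0 j Y ω'

variable {F N} in
omit [NeZero N] in
/-- The locality law holds at the unit residual `ζ0 := 1`, `quad := 0` (range witness, as 12a's `laws_one`). [cite: Balaban1988Convergent, (2.21) p.258 (bookkeeping)] -/
theorem TkResidualW.localLaws_one {V : Type} (K : ℕ) : (⟨fun _ _ _ => 1, fun _ _ _ => 0⟩ : TkResidualW F N V K).LocalLaws :=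
  ⟨fun _ _ _ _ _ _ => rfl⟩

/-- **PRINT'S PARTITION OF UNITY FOR THE RESIDUAL FACTOR, NAMED** (NOT a proviso; director LINE №92 (2) typing directive): `Σ_Y ζ0 j Y ω = 1` for every torus,
generation and configuration (the `ζ_j(R, S)` of (3.16)–(3.20) sum to one over the admissible large-field assignments).  Records with `Zt = 0` (admissible: every
§2 slot at `k ≥ 1` then vanishes, dag-ref-H (S3)) violate it; a consumer needing non-degenerate 𝐓-weights hypothesises `θ.ZtUnity`. [cite: Balaban1988Convergent, (3.16)–(3.20) pp.268–269] -/
def Stage12Params.ZtUnity (θ : Stage12Params F N) : Prop :=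
  ∀ (K j : ℕ) (ω : Tk.MultiCfg (F.P K) (SU N) (FluctV N)), (∑ᶠ Y : Set (Site (F.P K) 0), (θ.Zt K).ζ0 j Y ω) = 1

variable {F N} in
/-- **NON-DEGENERACY OF THE PRESENT SLOTS, NAMED** (NOT a proviso; dag-ref-D g21 WATCH-12-ZERO-BRANCH, director LINE №101 (1)): every slot of record at a
sequence in the range of its level's selector is not the zero density.  The zero branch of the §2 dichotomy (`HasSect2FormAtZ`) is keyed BY VALUE
(`slot s = 0`) because absence (`s ∉ range ppSel`) is not propagation-stable one level up; a consumer that must exclude vanishing PRESENT slots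
hypothesises this predicate on the same `θ` (№92 (2) typing directive).  Level 0 is never degenerate (`slotsNondegenerate_zero`, §7).
GUARDED BY THE TORUS (v2.3, (ι), director LINE №118): levels `k ≤ p.K` only — exactly the range in which the tuple DISPLAYS the slot's construction
(level `0`: `slotsNondegenerate_zero`; levels `k + 1 ≤ K`: the 𝐑-step proviso `rstep` of `Provisos₁₀`, fed by `tstep` ∕ `intPiece` at `k < K`); beyond `K`
the v2–v2.2 text quantified over slots transported along `avOfRecord F N p.K k` with no `HaarAC`, through `Classical.choice` Radon–Nikodym versions
(node00-def-K0b LOCATED-R4) — a junk region print never indexes ([III] (3.22), [IV] (0.3): the finite tower `k ≤ K`).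
[cite: Balaban1988Convergent, (3.22) p.269; Balaban1989LargeFieldI, (0.3) p.176] -/
def Stage12Params.SlotsNondegenerate (θ : Stage12Params F N) : Prop :=
  ∀ (p : B12.RunParams) (k : ℕ) (s : SeqOfRecord F θ.ν θ.τ9.M (gOfRecord₁₀ F N θ.toStage9Params p) p.K k), k ≤ p.K →
    s ∈ Set.range (θ.ppSel p (gOfRecord₁₀ F N θ.toStage9Params p) k) →
      slotsOfRecord F N θ.ν θ.τ9 (EOfRecord₁₀ F N θ.toStage9Params) (wOfRecord₉ F N θ.toStage9Params) θ.ppSel p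
        (gOfRecord₁₀ F N θ.toStage9Params p) k s ≠ 0

/-- **THE DISPLAYED PROVISOS at `θ : Stage12Params`** — 11d's with `wtLaws` REPLACED by `ztLaws` (12a's residual law `ζ0 ≥ 0`; the weight laws FOLLOW) and the
LOCALITY LAW `ztLocal` (dag-ref-D (S3′), director LINE №93 (1)), the uninhabitable `alphaPos` DROPPED (a theorem in the window: `alphaPos₁₂_of_window`), and `bg`
GUARDED by the coupling window of the run ((ε) of the header): `base` (Stage-10 provisos of the Stage-9 part), `rzLaws`, `ztLaws`, `ztLocal`, `bg` (def-R's
background of record in the spaces of record on the regular retained configurations, every run whose history stays in `]0, γ]` up to the length `n ≤ K`). [cite: Balaban1988Convergent, (2.7) p.255, (2.21) p.258, (2.28) p.259, (2.35) p.261; Balaban1987RG1, (1.15) p.262; Balaban1989LargeFieldI, (0.3)–(0.4) p.176] -/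
structure Stage12Params.Provisos₁₂ (θ : Stage12Params F N) : Prop where
  /-- the Stage-10 provisos of the Stage-9 part, verbatim -/
  base : θ.toStage9Params.Provisos₁₀
  /-- 11c's laws of the residual §2 data -/
  rzLaws : ∀ K, (θ.Rz K).Laws
  /-- 12a's law of the residual part of the 𝐓-weights: `ζ0 ≥ 0` -/
  ztLaws : ∀ K, (θ.Zt K).Laws
  /-- the locality law: `ζ0 j Y` reads only the scale-`j` step variables (dag-ref-D (S3′)) -/
  ztLocal : ∀ K, (θ.Zt K).LocalLaws
  /-- p. 259: def-R's background of record lies in the spaces of record on the regular retained configurations — every run WHOSE HISTORY STAYS IN THE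
  WINDOW `]0, γ]` up to the length `n ≤ K` (print's regime; outside it the radii (2.28) need not be positive and nothing is demanded) -/
  bg : ∀ (p : B12.RunParams) (n : ℕ), n ≤ p.K → Step.InInterval θ.γ n (gOfRecord₁₀ F N θ.toStage9Params p) →
    BgProviso F N p.K (settingOfRecord₁₂ F N θ p) (θ.Rz p.K) θ.τ9.M n (suppOfRecord₁₂ F N θ p n) (UbgOfRecord₁₂ F N θ p n)

variable {F N}

/-- The weight laws of the run FROM the provisos. [cite: Balaban1988Convergent, (2.21) p.258 (bookkeeping)] -/
theorem Stage12Params.Provisos₁₂.wtLaws {θ : Stage12Params F N} (h : θ.Provisos₁₂ F N) (p : B12.RunParams) : (WtOfRecord₁₂ F N θ p).Laws :=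
  WtOfRecord₁₂_laws h.ztLaws p

/-- The adapter's support-form provisos at the Stage-12 core FROM the provisos (as 11d). [cite: Balaban1989LargeFieldI, (0.3)–(0.4) p.176 (bookkeeping)] -/
theorem Stage12Params.Provisos₁₂.genTowerProvisosSupp {θ : Stage12Params F N} (h : θ.Provisos₁₂ F N) :
    GenTowerProvisosSupp F N θ.ν θ.τ9 (coreOfRecord₁₂ F N θ) (wOfRecord₉ F N θ.toStage9Params) θ.ppSel where
  tstep := fun p k hk => h.base.tstep p k hk
  rstep := fun p k _ hk => by convert h.base.rstep p k hk <;> rfl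

/-- … and along the histories `gOfRecord₁₀`. [cite: Balaban1989LargeFieldI, (0.3)–(0.4) p.176 (bookkeeping)] -/
theorem Stage12Params.Provisos₁₂.towerProvisosSupp {θ : Stage12Params F N} (h : θ.Provisos₁₂ F N) :
    TowerProvisosSupp F N θ.ν θ.τ9 (coreOfRecord₁₂ F N θ) (wOfRecord₉ F N θ.toStage9Params) θ.ppSel (gOfRecord₁₀ F N θ.toStage9Params) :=
  h.genTowerProvisosSupp.towerProvisosSupp

/-- The Stage-12 provisos carry the β-version proviso of Stage 10. [cite: Balaban1987RG1, (0.13) p.254 (bookkeeping)] -/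
theorem Stage12Params.Provisos₁₂.hasContTransportAlong {θ : Stage12Params F N} (h : θ.Provisos₁₂ F N) : θ.toStage8Params.HasContTransportAlong :=
  h.base.contT

/-- **NON-VACUITY OF THE SPACES OF RECORD AT THE RECORD, IN THE WINDOW**: at an admissible `θ` under the residual laws, at a level `j` whose coupling lies in
`]0, γ]`, the unit configuration lies in `U^c_j(Y, α_{0,j}, α_{1,j})` of record (11c's `Sect2.one_mem_spaceI`; radii by `alphaPos₁₂_of_window`).
[cite: Balaban1987RG1, (1.11)–(1.16) p.262; Balaban1988Convergent, (2.28) p.259] -/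
theorem one_mem_spaceI_stage12 {θ : Stage12Params F N} (h : θ.Provisos₁₂ F N) (hθ : θ.Admissible F N) (p : B12.RunParams) (j : ℕ) (Y : Set (Site (F.P p.K) 0))
    (hw : 0 < gOfRecord₁₀ F N θ.toStage9Params p j ∧ gOfRecord₁₀ F N θ.toStage9Params p j ≤ θ.γ) :
    Sect2.ofBackgroundC (ιSU N) (1 : GaugeField (F.P p.K) 0 (SU N)) ∈
      Sect2.spaceI (settingOfRecord₁₂ F N θ p) (θ.Rz p.K) θ.τ9.M j Y ((lfOfRecord₁₂ F N θ).alpha0 (gOfRecord₁₀ F N θ.toStage9Params p j))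
        ((lfOfRecord₁₂ F N θ).alpha1 (gOfRecord₁₀ F N θ.toStage9Params p j)) :=
  Sect2.one_mem_spaceI (settingOfRecord₁₂ F N θ p) hθ.pos.1 (h.rzLaws p.K) θ.τ9.M j Y (alphaPos₁₂_of_window hθ hw.1 hw.2).1
    (alphaPos₁₂_of_window hθ hw.1 hw.2).2

/-- … and in `Ũ^c_j(X, α̃₀, α̃₁)` of record along the sequence's large-field regions, GIVEN positive radii at every level (11c's `Sect2.one_mem_spaceMS` reads the
radii at all levels of the flow; in the window they are positive by `alphaPos₁₂_of_window`). [cite: Balaban1988Convergent, (2.34)–(2.39) p.261] -/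
theorem one_mem_spaceMS_stage12 {θ : Stage12Params F N} (h : θ.Provisos₁₂ F N) (hθ : θ.Admissible F N) (p : B12.RunParams) (j : ℕ) (Y : Set (Site (F.P p.K) 0))
    (Ω : ℕ → Set (Site (F.P p.K) 0))
    (hα : ∀ n, 0 < (lfOfRecord₁₂ F N θ).alpha0 (gOfRecord₁₀ F N θ.toStage9Params p n) ∧ 0 < (lfOfRecord₁₂ F N θ).alpha1 (gOfRecord₁₀ F N θ.toStage9Params p n)) :
    Sect2.ofBackgroundC (ιSU N) (1 : GaugeField (F.P p.K) 0 (SU N)) ∈ Sect2.spaceMS (settingOfRecord₁₂ F N θ p) (θ.Rz p.K) θ.τ9.M j Y Ω :=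
  Sect2.one_mem_spaceMS (settingOfRecord₁₂ F N θ p) (settingOfRecord₁₂_pos F N θ hθ.pos p) (h.rzLaws p.K) θ.τ9.M j Y Ω (fun n => (hα n).1) (fun n => (hα n).2)

/-- **THE (2.27)(iv) BOUND BITES AT THE BACKGROUND OF RECORD**, Stage 12: under the provisos, IN THE WINDOW (`0 < g_j ≤ γ`, `j ≤ k`), whenever `ρ_k` of the run has the repaired §2 form of record
(`SLaw₁₂`), its witnessing 𝐄-terms obey `|𝐄^{(j)}(X, U_k(s)(𝐖), z)| ≤ E₀ exp(−κ d_j(X))` POINTWISE at every regular retained configuration `𝐖`.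
[cite: Balaban1988Convergent, (2.23) p.258, (2.27)(iv)–(2.28) p.259] -/
theorem norm_E_bg_le_stage12 {θ : Stage12Params F N} (h : θ.Provisos₁₂ F N) (p : B12.RunParams) (k : ℕ) (hk : k ≤ p.K)
    (hw : Step.InInterval θ.γ k (gOfRecord₁₀ F N θ.toStage9Params p)) (hS : SLaw₁₂ F N θ p k) :
    ∃ t : SeqOfRecord F θ.ν θ.τ9.M (gOfRecord₁₀ F N θ.toStage9Params p) p.K k → Sect2.TermValues (F.P p.K) (MatA N) (FluctV N) θ.τ9.M,
      Sect2.UniversalE t ∧ ∀ s Wc, Wc ∈ suppOfRecord₁₂ F N θ p k s → ∀ j, 1 ≤ j → j ≤ k →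
        ∀ (X : (Sect2.domSys (F.P p.K) θ.τ9.M j).Dom) (z : Site (F.P p.K) j) (g' : ℝ), 0 ≤ g' → g' ≤ (lfOfRecord₁₂ F N θ).γ →
          ‖(t s).E j X z g' (Sect2.ofBackgroundC (ιSU N) (UbgOfRecord₁₂ F N θ p k s Wc))‖ ≤
            (lfOfRecord₁₂ F N θ).E₀ * Real.exp (-(lfOfRecord₁₂ F N θ).κ * (Sect2.domSys (F.P p.K) θ.τ9.M j).dj X) :=
  ((sLaw₁₂_iff F N θ p k).mp hS).norm_E_bg_le (h.bg p k hk hw)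

variable (F N)

/-! ## §5. The tower and the datum of record; faces -/

/-- **THE TOWER OF RECORD at `θ` under its provisos** (the support-form adapter at the Stage-12 core). [cite: Balaban1988Convergent, (0.2) p.244, (2.18) p.257, (3.25) p.270; Balaban1989LargeFieldI, (0.4) p.176] -/
def towerOfRecord₁₂ (θ : Stage12Params F N) (h : θ.Provisos₁₂ F N) : (coreOfRecord₁₂ F N θ).Tower (avOfRecord F N) :=
  towerOfRecord9GenSupp h.genTowerProvisosSupp

/-- **THE DATUM OF RECORD, STAGE 12**. [cite: Balaban1989LargeFieldII, Thm 1 + (0.1) pp.355–356; Balaban1988Convergent, (0.2) p.244] -/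
def datumOfRecord₁₂ (θ : Stage12Params F N) (h : θ.Provisos₁₂ F N) : FiniteEpsData F (SU N) :=
  datumOfTower F N (coreOfRecord₁₂ F N θ) (towerOfRecord₁₂ F N θ h)

/-- The tower's densities ARE `densOfRecord₁₀` (`rfl`). [cite: Balaban1988Convergent, (2.18) p.257 (bookkeeping)] -/
theorem towerOfRecord₁₂_ρ (θ : Stage12Params F N) (h : θ.Provisos₁₂ F N) (p : B12.RunParams) (k : ℕ) :
    (towerOfRecord₁₂ F N θ h).ρ p k = densOfRecord₁₀ F N θ.toStage9Params p k := rfl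

/-- The tower's `𝐓ρ_k` ARE `tdensOfRecord₁₀` (`rfl`). [cite: Balaban1988Convergent, (3.25) p.270 (bookkeeping)] -/
theorem towerOfRecord₁₂_Trho (θ : Stage12Params F N) (h : θ.Provisos₁₂ F N) (p : B12.RunParams) (k : ℕ) :
    (towerOfRecord₁₂ F N θ h).Trho p k = tdensOfRecord₁₀ F N θ.toStage9Params p k := rfl

/-- The tower of record is integrable. [cite: Balaban1988Convergent, (0.2) p.244 (bookkeeping)] -/
theorem isIntegrable_towerOfRecord₁₂ (θ : Stage12Params F N) (h : θ.Provisos₁₂ F N) : (towerOfRecord₁₂ F N θ h).IsIntegrable :=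
  isIntegrable_towerOfRecord9GenSupp h.genTowerProvisosSupp

/-- FACE `dens` (`rfl`). [cite: Balaban1988Convergent, (2.18) p.257 (bookkeeping)] -/
theorem dens_datumOfRecord₁₂ (θ : Stage12Params F N) (h : θ.Provisos₁₂ F N) (K : ℕ) (g₀ : ℝ) (k : ℕ) :
    (datumOfRecord₁₂ F N θ h).dens K g₀ k = densOfRecord₁₀ F N θ.toStage9Params ⟨K, F.m, g₀⟩ k := rfl

/-- FACE `Trho` (`rfl`). [cite: Balaban1988Convergent, (3.25) p.270 (bookkeeping)] -/
theorem trho_datumOfRecord₁₂ (θ : Stage12Params F N) (h : θ.Provisos₁₂ F N) (K : ℕ) (g₀ : ℝ) (k : ℕ) :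
    (datumOfRecord₁₂ F N θ h).real.Trho K g₀ k = tdensOfRecord₁₀ F N θ.toStage9Params ⟨K, F.m, g₀⟩ k := rfl

/-- FACE `𝐑` (`rfl`). [cite: Balaban1989LargeFieldI, (0.2)–(0.3) p.176 (bookkeeping)] -/
theorem R_datumOfRecord₁₂_eq_VOfRecord₁₂ (θ : Stage12Params F N) (h : θ.Provisos₁₂ F N) (K : ℕ) (g₀ : ℝ) (k : ℕ) :
    (datumOfRecord₁₂ F N θ h).real.R K g₀ k = (VOfRecord₁₂ F N θ ⟨K, F.m, g₀⟩).R k := rfl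

/-- … and maps `𝐓ρ_k ↦ ρ_{k+1}`. [cite: Balaban1988Convergent, (0.2) p.244; Balaban1989LargeFieldI, (0.3) p.176] -/
theorem R_tdens_datumOfRecord₁₂ (θ : Stage12Params F N) (h : θ.Provisos₁₂ F N) (K : ℕ) (g₀ : ℝ) (k : ℕ) :
    (datumOfRecord₁₂ F N θ h).real.R K g₀ k (tdensOfRecord₁₀ F N θ.toStage9Params ⟨K, F.m, g₀⟩ k) =
      densOfRecord₁₀ F N θ.toStage9Params ⟨K, F.m, g₀⟩ (k + 1) :=
  (towerOfRecord₁₂ F N θ h).inducedR_Trho ⟨K, F.m, g₀⟩ k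

/-- FACE construction (`rfl`). [cite: Balaban1989LargeFieldII, Thm 1 + (0.1) pp.355–356 (bookkeeping)] -/
theorem datumOfRecord₁₂_C (θ : Stage12Params F N) (h : θ.Provisos₁₂ F N) :
    (datumOfRecord₁₂ F N θ h).C = (coreOfRecord₁₂ F N θ).construction (densOfRecord₁₀ F N θ.toStage9Params) := rfl

/-- FACE β (`rfl`). [cite: Balaban1987RG1, (1.20)–(1.22) p.264 (bookkeeping)] -/
theorem βfun_datumOfRecord₁₂ (θ : Stage12Params F N) (h : θ.Provisos₁₂ F N) : (datumOfRecord₁₂ F N θ h).βfun = betaOfRecord₁₀ F N θ.toStage9Params := rfl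

/-- FACE flow (`rfl`). [cite: Balaban1987RG1, (0.17)–(0.20) pp.255–256 (bookkeeping)] -/
theorem flow_g_datumOfRecord₁₂ (θ : Stage12Params F N) (h : θ.Provisos₁₂ F N) (p : B12.RunParams) :
    ((datumOfRecord₁₂ F N θ h).C p).flow.g = gOfRecord₁₀ F N θ.toStage9Params p := rfl

/-- FACE av (`rfl`). [cite: Balaban1987RG1, (0.4) p.253 (bookkeeping)] -/
theorem av_datumOfRecord₁₂ (θ : Stage12Params F N) (h : θ.Provisos₁₂ F N) : (datumOfRecord₁₂ F N θ h).av = avOfRecord F N := rfl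

/-- STAGE-0 DATUM CLAUSE at the Stage-12 datum (`rfl`). [cite: Balaban1987RG1, (0.3)–(0.4) p.253] -/
theorem isDatumOfRecord₀_datumOfRecord₁₂ (θ : Stage12Params F N) (h : θ.Provisos₁₂ F N) : IsDatumOfRecord₀ F N (datumOfRecord₁₂ F N θ h) := rfl

/-- BINDER B1 = NODE N23 at the Stage-12 datum. [cite: Balaban1987RG1, (0.4) p.253] -/
theorem isPrintedAveraged_datumOfRecord₁₂ (θ : Stage12Params F N) (h : θ.Provisos₁₂ F N) : (datumOfRecord₁₂ F N θ h).IsPrintedAveraged :=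
  isPrintedAveraged_datumOfTower F N _ _

/-- FACE χ ∕ actions ∕ `IndAss` ∕ `Repr`: the Stage-10 fields VERBATIM at the Stage-9 part. [cite: Balaban1987RG1, (0.17)–(0.24) pp.255–257 (bookkeeping)] -/
theorem actionSide_stage12 (θ : Stage12Params F N) (h : θ.Provisos₁₂ F N) (p : B12.RunParams) (k : ℕ) :
    ((datumOfRecord₁₂ F N θ h).C p).χ k = (coreOfRecord₁₀ F N θ.toStage9Params).χ p k ∧
      ((datumOfRecord₁₂ F N θ h).C p).effAction k = (coreOfRecord₁₀ F N θ.toStage9Params).effAction p k ∧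
        ((datumOfRecord₁₂ F N θ h).C p).Ek k = (coreOfRecord₁₀ F N θ.toStage9Params).Ek p k ∧
          (((datumOfRecord₁₂ F N θ h).C p).IndAss k ↔ (coreOfRecord₁₀ F N θ.toStage9Params).IndAss p k) ∧
            (((datumOfRecord₁₂ F N θ h).C p).Repr k ↔ (coreOfRecord₁₀ F N θ.toStage9Params).Repr p k) :=
  ⟨rfl, rfl, rfl, Iff.rfl, Iff.rfl⟩

/-- **FACE `Sect2Form` — THE REPAIRED PIN AT THE WEIGHTS OF RECORD**: the construction's §2 [III] clause at step `k` IS the repaired §2 form of the post-𝐑 slot family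
of `ρ_k` at the setting, residual §2 data, THE 𝐓-WEIGHTS OF RECORD OF THE RUN and def-R's background maps. [cite: Balaban1988Convergent, (2.17)–(2.18) p.257, (2.23)–(2.42) pp.258–261, Thm 1 p.262] -/
theorem sect2Form_stage12_iff (θ : Stage12Params F N) (h : θ.Provisos₁₂ F N) (p : B12.RunParams) (k : ℕ) :
    ((datumOfRecord₁₂ F N θ h).C p).Sect2Form k ↔
      HasSect2FormAEZ F N (FluctV N) p.K (settingOfRecord₁₂ F N θ p) (θ.Rz p.K) (WtOfRecord₁₂ F N θ p) k
        (UbgOfRecord₁₂ F N θ p k)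
        (slotsOfRecord F N θ.ν θ.τ9 (EOfRecord₁₀ F N θ.toStage9Params) (wOfRecord₉ F N θ.toStage9Params) θ.ppSel p
          (gOfRecord₁₀ F N θ.toStage9Params p) k) :=
  sLaw₁₂_iff F N θ p k

/-- (2.18) holds for the datum's densities with `rep_k` of record, by construction. [cite: Balaban1988Convergent, (2.18) p.257] -/
theorem holds_dens_datumOfRecord₁₂ (θ : Stage12Params F N) (h : θ.Provisos₁₂ F N) (K : ℕ) (g₀ : ℝ) (k : ℕ) :
    (reprOfRecord₁₀ F N θ.toStage9Params ⟨K, F.m, g₀⟩ k).Holds ((datumOfRecord₁₂ F N θ h).dens K g₀ k) :=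
  holds_densOfRecord₁₀ F N θ.toStage9Params _ k

/-- FACE Wilson start. [cite: Balaban1988Convergent, Thm 1 p.262] -/
theorem dens_zero_datumOfRecord₁₂ (θ : Stage12Params F N) (h : θ.Provisos₁₂ F N) (K : ℕ) (g₀ : ℝ) :
    (datumOfRecord₁₂ F N θ h).dens K g₀ 0 = rhoZeroOfRecord F N K g₀ (EOfRecord₁₀ F N θ.toStage9Params ⟨K, F.m, g₀⟩) :=
  densOfRecord₁₀_zero F N θ.toStage9Params ⟨K, F.m, g₀⟩

/-- FACE push-forward: `𝐓ρ_k` IS an averaging-of-record image of `ρ_k` (`k < K`). [cite: Balaban1988Convergent, (3.1) p.264, (3.24)–(3.25) p.270] -/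
theorem isRT_trho_datumOfRecord₁₂ (θ : Stage12Params F N) (h : θ.Provisos₁₂ F N) (K : ℕ) (g₀ : ℝ) (k : ℕ) (hk : k < K) :
    IsRT (avOfRecord F N K k).avg ((datumOfRecord₁₂ F N θ h).dens K g₀ k) ((datumOfRecord₁₂ F N θ h).real.Trho K g₀ k) :=
  (towerOfRecord₁₂ F N θ h).isRT_Trho ⟨K, F.m, g₀⟩ k hk

/-- FACE (0.4) at the step: `∫ρ_{k+1} = ∫𝐓ρ_k` (`k < K`). [cite: Balaban1989LargeFieldI, (0.4) p.176] -/
theorem integral_dens_succ_datumOfRecord₁₂ (θ : Stage12Params F N) (h : θ.Provisos₁₂ F N) (K : ℕ) (g₀ : ℝ) (k : ℕ) (hk : k < K) :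
    ∫ V, (datumOfRecord₁₂ F N θ h).dens K g₀ (k + 1) V ∂fieldMeasure (F.P K) (k + 1) (SU N)
      = ∫ V, (datumOfRecord₁₂ F N θ h).real.Trho K g₀ k V ∂fieldMeasure (F.P K) (k + 1) (SU N) :=
  (towerOfRecord₁₂ F N θ h).integral_succ ⟨K, F.m, g₀⟩ k hk

/-- `∫ρ_k = ∫ρ₀` along every run, `k ≤ K`. [cite: Balaban1985UV3, (6) p.257] -/
theorem integral_dens_eq_zero_datumOfRecord₁₂ (θ : Stage12Params F N) (h : θ.Provisos₁₂ F N) (K : ℕ) (g₀ : ℝ) (k : ℕ) (hk : k ≤ K) :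
    ∫ V, (datumOfRecord₁₂ F N θ h).dens K g₀ k V ∂fieldMeasure (F.P K) k (SU N)
      = ∫ U, (datumOfRecord₁₂ F N θ h).dens K g₀ 0 U ∂fieldMeasure (F.P K) 0 (SU N) :=
  (towerOfRecord₁₂ F N θ h).integral_eq_integral_zero ⟨K, F.m, g₀⟩ k hk

/-- FACE integrability: every density of the datum, `k ≤ K`, is integrable. [cite: Balaban1988Convergent, (0.2) p.244 (bookkeeping)] -/
theorem integrable_dens_datumOfRecord₁₂ (θ : Stage12Params F N) (h : θ.Provisos₁₂ F N) (K : ℕ) (g₀ : ℝ) (k : ℕ) (hk : k ≤ K) :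
    Integrable ((datumOfRecord₁₂ F N θ h).dens K g₀ k) (fieldMeasure (F.P K) k (SU N)) :=
  isIntegrable_towerOfRecord₁₂ F N θ h ⟨K, F.m, g₀⟩ k hk

/-- … and so is every realised `𝐓ρ_k`, `k < K`. [cite: Balaban1988Convergent, (3.25) p.270 (bookkeeping)] -/
theorem integrable_trho_datumOfRecord₁₂ (θ : Stage12Params F N) (h : θ.Provisos₁₂ F N) (K : ℕ) (g₀ : ℝ) (k : ℕ) (hk : k < K) :
    Integrable ((datumOfRecord₁₂ F N θ h).real.Trho K g₀ k) (fieldMeasure (F.P K) (k + 1) (SU N)) :=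
  integrable_towerOfRecord9Supp_Trho h.towerProvisosSupp ⟨K, F.m, g₀⟩ k hk

/-- The T⁴ apex at the Stage-12 datum, B1 eliminated. [cite: JaffeWittenClay2006, §6.5 p.11] -/
theorem continuumYM4Torus_datumOfRecord₁₂ (θ : Stage12Params F N) (h : θ.Provisos₁₂ F N)
    (hB : B16.EndStatementBPrinted (datumOfRecord₁₂ F N θ h).C)
    (hE : EndpointExistence (datumOfRecord₁₂ F N θ h).C.toB12)
    (hNE : T4ApexHybrid.HybridNE7Under (datumOfRecord₁₂ F N θ h) (EndpointExistence (datumOfRecord₁₂ F N θ h).C.toB12)) :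
    T4ContinuumYM4Torus.ContinuumYM4Torus (datumOfRecord₁₂ F N θ h) :=
  continuumYM4Torus_datumOfTower F N _ _ hB hE hNE

/-! ## §5b. [V] Theorem 1's printed induction AT THE STAGE-12 DATUM: the BASE is a theorem; the STEP from the 𝐓-step law and the 𝐑-leaf -/

/-- **THE BASE HOLDS**: the construction's §2 clause at step 0 holds on EVERY run of the Stage-12 datum (it IS `SLaw₁₂ θ P 0`, a theorem: `sLaw₁₂_zero`) — the
located Stage-11 defect (`B16Thm1BaseAtRecord11.not_sect2Form_zero_datumOfRecord₁₁`) is gone. [cite: Balaban1988Convergent, Thm 1 p.262; Balaban1989LargeFieldII, Thm 1 p.355 (bookkeeping)] -/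
theorem sect2Form_zero_datumOfRecord₁₂ (θ : Stage12Params F N) (h : θ.Provisos₁₂ F N) (P : B12.RunParams) :
    ((datumOfRecord₁₂ F N θ h).C P).Sect2Form 0 :=
  (sect2Form_stage12_iff F N θ h P 0).mpr ((sLaw₁₂_iff F N θ P 0).mp (sLaw₁₂_zero F N θ P))

/-- **`B16.InductionBase` AT THE STAGE-12 DATUM, for every window letter `γ`, NO hypothesis.** [cite: Balaban1988Convergent, Thm 1 p.262; Balaban1989LargeFieldII, Thm 1 p.355 + p.391] -/
theorem inductionBase_datumOfRecord₁₂ (θ : Stage12Params F N) (h : θ.Provisos₁₂ F N) (γ : ℝ) : B16.InductionBase (datumOfRecord₁₂ F N θ h).C γ :=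
  fun P _ => sect2Form_zero_datumOfRecord₁₂ F N θ h P

/-- **THE STEP OF THEOREM 1 AT THE OBJECTS OF RECORD, Stage 12** (n13-e's `inductionStep_datumOfRecord₁₁_of_tLaw_rOpLeaf`, re-keyed): along every run in the
`γ`-window, from the 𝐓-STEP LAW «`SLaw₁₂ k → TLaw₁₂ k`» ([III] Thm p. 245 ∕ §3 — node N11's product) and the 𝐑-LEAF `ROpLeaf (VOfRecord₁₂ θ P)` (= «`TLaw₁₂ k →
SLaw₁₂ (k+1)`, `k < K`» — [V] Thm 1 for 𝐑, node N13's conjunct).  Both hypotheses DISPLAYED. [cite: Balaban1989LargeFieldII, Thm 1 p.355 and pp.390–391; Balaban1988Convergent, Thm p.245, Thm 2 p.263] -/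
theorem inductionStep_datumOfRecord₁₂_of_tLaw_rOpLeaf (θ : Stage12Params F N) (h : θ.Provisos₁₂ F N) (γ : ℝ)
    (hT : ∀ P : B12.RunParams, ((datumOfRecord₁₂ F N θ h).C P).flow.InInterval γ P.K →
      ∀ k, k < P.K → SLaw₁₂ F N θ P k → TLaw₁₂ F N θ P k)
    (hR : ∀ P : B12.RunParams, ((datumOfRecord₁₂ F N θ h).C P).flow.InInterval γ P.K → ROpLeaf (VOfRecord₁₂ F N θ P)) :
    B16.InductionStep (datumOfRecord₁₂ F N θ h).C γ := by
  intro P hP k hk hS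
  have hS' : SLaw₁₂ F N θ P k := (sLaw₁₂_iff F N θ P k).mpr ((sect2Form_stage12_iff F N θ h P k).mp hS)
  exact (sect2Form_stage12_iff F N θ h P (k + 1)).mpr
    ((sLaw₁₂_iff F N θ P (k + 1)).mp ((rOpLeaf_VOfRecord₁₂_iff F N θ P).mp (hR P hP) k hk (hT P hP k hk hS')))

/-- **[V] THEOREM 1 AT THE STAGE-12 DATUM FROM ITS PRINTED PIECES WITHOUT A BASE HYPOTHESIS** (`B16.thm1_of_steps`; the base is `inductionBase_datumOfRecord₁₂`):
𝐓-step law + 𝐑-leaf along the runs in a `γ`-window ⊢ `B16.Thm1Printed`. [cite: Balaban1989LargeFieldII, Thm 1 p.355 + p.391; Balaban1988Convergent, Thm 1 p.262, Thm p.245, Thm 2 p.263] -/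
theorem thm1Printed_datumOfRecord₁₂_of_tLaw_rOpLeaf (θ : Stage12Params F N) (h : θ.Provisos₁₂ F N) {γ : ℝ} (hγ : 0 < γ)
    (hT : ∀ P : B12.RunParams, ((datumOfRecord₁₂ F N θ h).C P).flow.InInterval γ P.K →
      ∀ k, k < P.K → SLaw₁₂ F N θ P k → TLaw₁₂ F N θ P k)
    (hR : ∀ P : B12.RunParams, ((datumOfRecord₁₂ F N θ h).C P).flow.InInterval γ P.K → ROpLeaf (VOfRecord₁₂ F N θ P)) :
    B16.Thm1Printed (datumOfRecord₁₂ F N θ h).C :=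
  B16.thm1_of_steps _ γ hγ (inductionBase_datumOfRecord₁₂ F N θ h γ) (inductionStep_datumOfRecord₁₂_of_tLaw_rOpLeaf F N θ h γ hT hR)

/-! ## §6. The Stage-12 record predicate (C-binding) -/

/-- **«(D, w) is the record, Stage 12»**: admissible Stage-12 parameters SATISFYING THEIR DISPLAYED PROVISOS whose datum of record IS `D`, and a world bound to its
construction with a window `0 < w.γ ≤ θ.γ`, Bałaban's block size and the C-binding of record over the Stage-12 view (whose 𝐑-leaf carries the REPAIRED §2 format of
record at the 𝐓-weights of record). [cite: Balaban1989LargeFieldII, Thm 1 + (0.1) pp.355–356; Balaban1988Convergent, (0.2) p.244, (2.17)–(2.18) p.257, Thms 1–2 pp.262–263; Balaban1989LargeFieldI, (0.2)–(0.4) p.176 (objects of record; bookkeeping)] -/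
def IsRecordOfRecord₁₂C (D : FiniteEpsData F (SU N)) (w : WorldP) : Prop :=
  ∃ (θ : Stage12Params F N) (h : θ.Provisos₁₂ F N), θ.Admissible F N ∧ D = datumOfRecord₁₂ F N θ h ∧ w.C = D.C ∧ (0 < w.γ ∧ w.γ ≤ θ.γ) ∧
    w.L = (θ.L : ℝ) ∧ ∀ P : B12.RunParams, w.up P = upOfRecord₅C F N (θ.toStage5₁₂ F N) P

/-- **Pointed form**. [cite: Balaban1989LargeFieldII, Thm 1 + (0.1) pp.355–356 (bookkeeping)] -/
theorem isRecordOfRecord₁₂C_of_eq (θ : Stage12Params F N) (h : θ.Provisos₁₂ F N) (hθ : θ.Admissible F N) (w : WorldP)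
    (hC : w.C = (datumOfRecord₁₂ F N θ h).C) (hγ : 0 < w.γ ∧ w.γ ≤ θ.γ) (hL : w.L = (θ.L : ℝ))
    (hup : ∀ P, w.up P = upOfRecord₅C F N (θ.toStage5₁₂ F N) P) :
    IsRecordOfRecord₁₂C F N (datumOfRecord₁₂ F N θ h) w :=
  ⟨θ, h, hθ, rfl, hC, hγ, hL, hup⟩

/-- **Every admissible Stage-12 parameter satisfying its provisos IS a Stage-12 record at some world**, with any window `0 < γw ≤ θ.γ`.
[cite: Balaban1989LargeFieldII, Thm 1 + (0.1) pp.355–356 (bookkeeping)] -/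
theorem exists_world_isRecordOfRecord₁₂C (θ : Stage12Params F N) (h : θ.Provisos₁₂ F N) (hθ : θ.Admissible F N) {γw : ℝ} (hγw : 0 < γw ∧ γw ≤ θ.γ) :
    ∃ w : WorldP, IsRecordOfRecord₁₂C F N (datumOfRecord₁₂ F N θ h) w ∧ w.γ = γw := by
  obtain ⟨w₀⟩ := nonempty_worldP
  exact ⟨{ w₀ with
      C := (datumOfRecord₁₂ F N θ h).C, γ := γw, L := (θ.L : ℝ), one_lt_L := by exact_mod_cast θ.hL.2,
      up := fun P => upOfRecord₅C F N (θ.toStage5₁₂ F N) P },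
    ⟨θ, h, hθ, rfl, rfl, hγw, rfl, fun _ => rfl⟩, rfl⟩

section Consequences

variable {F N}
variable {D : FiniteEpsData F (SU N)} {w : WorldP}

/-- A Stage-12 record CERTIFIES its parameters' provisos and admissibility. [cite: Balaban1989LargeFieldI, (0.3)–(0.4) p.176 (bookkeeping)] -/
theorem exists_provisos_of_isRecordOfRecord₁₂C (h : IsRecordOfRecord₁₂C F N D w) :
    ∃ (θ : Stage12Params F N) (hP : θ.Provisos₁₂ F N), θ.Admissible F N ∧ D = datumOfRecord₁₂ F N θ hP := by
  obtain ⟨θ, hP, hθ, hD, -⟩ := h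
  exact ⟨θ, hP, hθ, hD⟩

/-- Binding clause 1: the world's construction IS the datum's. [cite: Balaban1989LargeFieldII, Thm 1 p.355 (bookkeeping)] -/
theorem construction_eq_of_isRecordOfRecord₁₂C (h : IsRecordOfRecord₁₂C F N D w) : w.C = D.C := by
  obtain ⟨θ, hP, -, -, hC, -⟩ := h
  exact hC

/-- Binding clause 2: the interval constant is positive. [cite: Balaban1989LargeFieldII, Thm 1 p.355 (bookkeeping)] -/
theorem gamma_pos_of_isRecordOfRecord₁₂C (h : IsRecordOfRecord₁₂C F N D w) : 0 < w.γ := by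
  obtain ⟨θ, hP, -, -, -, hγ, -⟩ := h
  exact hγ.1

/-- A Stage-12 record's datum is a datum of record, Stage 0. [cite: Balaban1987RG1, (0.3)–(0.4) p.253 (bookkeeping)] -/
theorem isDatumOfRecord₀_of_isRecordOfRecord₁₂C (h : IsRecordOfRecord₁₂C F N D w) : IsDatumOfRecord₀ F N D := by
  obtain ⟨θ, hP, -, rfl, -⟩ := h
  exact isDatumOfRecord₀_datumOfRecord₁₂ F N θ hP

/-- N23 · binder B1 at every Stage-12 record. [cite: Balaban1987RG1, (0.4) p.253] -/
theorem isPrintedAveraged_of_isRecordOfRecord₁₂C (h : IsRecordOfRecord₁₂C F N D w) : D.IsPrintedAveraged :=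
  isPrintedAveraged_of_isDatumOfRecord₀ F N D (isDatumOfRecord₀_of_isRecordOfRecord₁₂C h)

/-- **A Stage-12 record's 𝐑-leaf IS «repaired 𝐓-image form ⇒ repaired §2 form one level up» along its tower of record**, at every run.
[cite: Balaban1988Convergent, p.244, Thm 2 p.263; Balaban1989LargeFieldII, Thm 1 p.355 (bookkeeping)] -/
theorem exists_rOperation_iff_of_isRecordOfRecord₁₂C (h : IsRecordOfRecord₁₂C F N D w) :
    ∃ (θ : Stage12Params F N) (hP : θ.Provisos₁₂ F N), θ.Admissible F N ∧ D = datumOfRecord₁₂ F N θ hP ∧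
      ∀ P : B12.RunParams, (leavesP w P).rOperation ↔ ∀ k, k < P.K → TLaw₁₂ F N θ P k → SLaw₁₂ F N θ P (k + 1) := by
  obtain ⟨θ, hP, hθ, hD, -, -, -, hup⟩ := h
  refine ⟨θ, hP, hθ, hD, fun P => ?_⟩
  show (w.up P).rOperation ↔ _
  rw [hup P]
  exact rOperation_upOfRecord₅C_stage12_iff F N θ P

/-- **AT A STAGE-12 RECORD WHOSE 𝐑-LEAVES HOLD, EVERY `ρ_{k+1}` WHOSE `𝐓ρ_k` HAS THE 𝐓-IMAGE FORM HAS THE REPAIRED §2 FORM OF RECORD AT THE WEIGHTS OF RECORD.**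
[cite: Balaban1988Convergent, Thm 2 p.263, (2.18) p.257, (2.23) p.258 (bookkeeping)] -/
theorem hasSect2FormAEZ_succ_of_isRecordOfRecord₁₂C (h : IsRecordOfRecord₁₂C F N D w) (hR : ∀ P : B12.RunParams, (leavesP w P).rOperation) :
    ∃ (θ : Stage12Params F N) (hP : θ.Provisos₁₂ F N), θ.Admissible F N ∧ D = datumOfRecord₁₂ F N θ hP ∧
      ∀ (P : B12.RunParams) (k : ℕ), k < P.K → TLaw₁₂ F N θ P k →
        HasSect2FormAEZ F N (FluctV N) P.K (settingOfRecord₁₂ F N θ P) (θ.Rz P.K) (WtOfRecord₁₂ F N θ P) (k + 1)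
          (UbgOfRecord₁₂ F N θ P (k + 1))
          (slotsOfRecord F N θ.ν θ.τ9 (EOfRecord₁₀ F N θ.toStage9Params) (wOfRecord₉ F N θ.toStage9Params) θ.ppSel P
            (gOfRecord₁₀ F N θ.toStage9Params P) (k + 1)) := by
  obtain ⟨θ, hP, hθ, hD, hrop⟩ := exists_rOperation_iff_of_isRecordOfRecord₁₂C h
  exact ⟨θ, hP, hθ, hD, fun P k hk hT => (sLaw₁₂_iff F N θ P (k + 1)).mp (((hrop P).mp (hR P)) k hk hT)⟩

/-- **AT A STAGE-12 RECORD WHOSE 𝐑-LEAVES HOLD, [V] THEOREM 1 FOLLOWS FROM THE 𝐓-STEP LAW ALONE** (any window letter `γ > 0`): the base is a theorem, the 𝐑-half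
of the step is the leaf; what remains displayed is N11's product «`SLaw₁₂ k → TLaw₁₂ k`» along the runs in the window.
[cite: Balaban1989LargeFieldII, Thm 1 p.355 + p.391; Balaban1988Convergent, Thm 1 p.262, Thm p.245, Thm 2 p.263 (bookkeeping)] -/
theorem thm1Printed_of_isRecordOfRecord₁₂C_of_tLaw (h : IsRecordOfRecord₁₂C F N D w) (hR : ∀ P : B12.RunParams, (leavesP w P).rOperation) :
    ∃ (θ : Stage12Params F N) (hP : θ.Provisos₁₂ F N), θ.Admissible F N ∧ D = datumOfRecord₁₂ F N θ hP ∧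
      ∀ γ : ℝ, 0 < γ → (∀ P : B12.RunParams, (D.C P).flow.InInterval γ P.K → ∀ k, k < P.K → SLaw₁₂ F N θ P k → TLaw₁₂ F N θ P k) →
        B16.Thm1Printed D.C := by
  obtain ⟨θ, hP, hθ, hD, hrop⟩ := exists_rOperation_iff_of_isRecordOfRecord₁₂C h
  refine ⟨θ, hP, hθ, hD, fun γ hγ hT => ?_⟩
  subst hD
  exact thm1Printed_datumOfRecord₁₂_of_tLaw_rOpLeaf F N θ hP hγ hT
    (fun P _ => (rOpLeaf_VOfRecord₁₂_iff F N θ P).mpr ((hrop P).mp (hR P)))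

/-- Slots of record at level 0 are never degenerate (positivity of `ρ₀`): the level-0 instance of `Stage12Params.SlotsNondegenerate` is a theorem.
[cite: Balaban1988Convergent, Thm 1 p.262 (bookkeeping)] -/
theorem slotsNondegenerate_zero (θ : Stage12Params F N) (p : B12.RunParams)
    (s : SeqOfRecord F θ.ν θ.τ9.M (gOfRecord₁₀ F N θ.toStage9Params p) p.K 0) :
    slotsOfRecord F N θ.ν θ.τ9 (EOfRecord₁₀ F N θ.toStage9Params) (wOfRecord₉ F N θ.toStage9Params) θ.ppSel p
        (gOfRecord₁₀ F N θ.toStage9Params p) 0 s ≠ 0 := by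
  intro h0
  obtain ⟨V₀⟩ := (inferInstance : Nonempty (GaugeField (F.P p.K) 0 (SU N)))
  have := B16Thm1BaseAtRecord11.slotsOfRecord_zero_pos F N θ.ν θ.τ9 (EOfRecord₁₀ F N θ.toStage9Params) (wOfRecord₉ F N θ.toStage9Params) θ.ppSel p
    (gOfRecord₁₀ F N θ.toStage9Params p) s V₀
  rw [h0] at this
  exact lt_irrefl _ this

end Consequences

/-! ## §7. The shadow; refinement to the Stage-5 record predicate AT THE SHADOW; transfer of world-reading theorems -/

/-- **THE SHADOW RESIDUAL of `θ` under its provisos** (as 11d: `R :=` the induced operation at the Radon–Nikodym image of the tower of record, the format slot FROZEN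
at the density of record).  A PROOF DEVICE. [cite: Balaban1989LargeFieldI, (0.2)–(0.4) p.176; Balaban1987RG1, (0.13) p.254 (bookkeeping)] -/
def shadowResidual₁₂ (θ : Stage12Params F N) (h : θ.Provisos₁₂ F N) : Residual₅ F N :=
  { residualOfStage12 F N θ with
    R := fun p k => (towerOfRecord₁₂ F N θ h).shadowR p k
    preservesIntegral_R := fun p k hk => preservesIntegral_shadowR_towerOfRecord9Supp h.towerProvisosSupp p k hk
    integrable_R := fun p k hk => integrable_shadowR_towerOfRecord9Supp h.towerProvisosSupp p k hk
    S218 := fun p k _ => S218OfRecord₁₂ F N θ p k (densOfRecord₁₀ F N θ.toStage9Params p k) }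

/-- **THE SHADOW Stage-5 parameters of `θ`** at interval letter `γ'`. [cite: Balaban1989LargeFieldI, (0.2) p.176 (bookkeeping)] -/
def shadow₅OfRecord₁₂ (θ : Stage12Params F N) (h : θ.Provisos₁₂ F N) (γ' : ℝ) : Stage5Params F N :=
  { θ.toStage5Params with γ := γ', res := shadowResidual₁₂ F N θ h }

/-- THE KEY `rfl`: the machine of the shadow has core `coreOfRecord₁₂ θ`. [cite: Balaban1988Convergent, (0.2) p.244 (bookkeeping)] -/
theorem toCore_machineOfRecord₅_shadow₁₂ (θ : Stage12Params F N) (h : θ.Provisos₁₂ F N) (γ' : ℝ) :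
    (machineOfRecord₅ F N (shadow₅OfRecord₁₂ F N θ h γ')).toCore = coreOfRecord₁₂ F N θ := rfl

/-- The shadow's residual `R` IS the tower's shadow operation (`rfl`). [cite: Balaban1989LargeFieldI, (0.3) p.176 (bookkeeping)] -/
theorem res_R_shadow₁₂ (θ : Stage12Params F N) (h : θ.Provisos₁₂ F N) (γ' : ℝ) (p : B12.RunParams) (k : ℕ) :
    (shadow₅OfRecord₁₂ F N θ h γ').res.R p k = (towerOfRecord₁₂ F N θ h).shadowR p k := rfl

/-- The shadow is Stage-5 admissible iff `θ`'s Stage-1 dictionary is admissible and `0 < γ'`. [cite: Balaban1989LargeFieldII, Thm 1 p.355 (bookkeeping)] -/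
theorem admissible_shadow₁₂ (θ : Stage12Params F N) (h : θ.Provisos₁₂ F N) {γ' : ℝ} (hθ : θ.Admissible F N) (hγ' : 0 < γ') :
    (shadow₅OfRecord₁₂ F N θ h γ').Admissible :=
  ⟨hθ.1.1.1.1.1, hγ'⟩

/-- The shadow's upstream block IS the Stage-12 view's (`rfl`). [cite: Balaban1985UV3, Thm 1 p.257 (bookkeeping)] -/
theorem upOfRecord₅C_shadow₁₂ (θ : Stage12Params F N) (h : θ.Provisos₁₂ F N) (γ' : ℝ) (P : B12.RunParams) :
    upOfRecord₅C F N (shadow₅OfRecord₁₂ F N θ h γ') P = upOfRecord₅C F N (θ.toStage5₁₂ F N) P := rfl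

/-- The shadow datum has the SAME CONSTRUCTION as the Stage-12 datum. [cite: Balaban1989LargeFieldII, Thm 1 + (0.1) pp.355–356 (bookkeeping)] -/
theorem datumOfRecord₅_shadow₁₂_C (θ : Stage12Params F N) (h : θ.Provisos₁₂ F N) (γ' : ℝ) :
    (datumOfRecord₅ F N (shadow₅OfRecord₁₂ F N θ h γ')).C = (datumOfRecord₁₂ F N θ h).C :=
  datumOfRecord_C_eq_datumOfTower F N (machineOfRecord₅ F N (shadow₅OfRecord₁₂ F N θ h γ')) (towerOfRecord₁₂ F N θ h) (fun _ _ => rfl)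

/-- … the same densities. [cite: Balaban1988Convergent, (0.2) p.244 (bookkeeping)] -/
theorem dens_datumOfRecord₅_shadow₁₂ (θ : Stage12Params F N) (h : θ.Provisos₁₂ F N) (γ' : ℝ) (K : ℕ) (g₀ : ℝ) (k : ℕ) :
    (datumOfRecord₅ F N (shadow₅OfRecord₁₂ F N θ h γ')).dens K g₀ k = (datumOfRecord₁₂ F N θ h).dens K g₀ k :=
  dens_datumOfRecord_eq_datumOfTower F N (machineOfRecord₅ F N (shadow₅OfRecord₁₂ F N θ h γ')) (towerOfRecord₁₂ F N θ h) (fun _ _ => rfl) K g₀ k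

/-- … the same β-functions (`rfl`). [cite: Balaban1987RG1, (1.22) p.264 (bookkeeping)] -/
theorem βfun_datumOfRecord₅_shadow₁₂ (θ : Stage12Params F N) (h : θ.Provisos₁₂ F N) (γ' : ℝ) :
    (datumOfRecord₅ F N (shadow₅OfRecord₁₂ F N θ h γ')).βfun = (datumOfRecord₁₂ F N θ h).βfun := rfl

/-- … and the same averaging maps (`rfl`). [cite: Balaban1987RG1, (0.4) p.253 (bookkeeping)] -/
theorem av_datumOfRecord₅_shadow₁₂ (θ : Stage12Params F N) (h : θ.Provisos₁₂ F N) (γ' : ℝ) :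
    (datumOfRecord₅ F N (shadow₅OfRecord₁₂ F N θ h γ')).av = (datumOfRecord₁₂ F N θ h).av := rfl

/-- **A STAGE-12 WORLD IS A STAGE-5 RECORD AT THE SHADOW DATUM**. [cite: Balaban1989LargeFieldII, Thm 1 + (0.1) pp.355–356 (bookkeeping)] -/
theorem isRecordOfRecord₅C_shadow₁₂ (θ : Stage12Params F N) (h : θ.Provisos₁₂ F N) (hθ : θ.Admissible F N) (w : WorldP)
    (hC : w.C = (datumOfRecord₁₂ F N θ h).C) (hγ : 0 < w.γ) (hL : w.L = (θ.L : ℝ))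
    (hup : ∀ P, w.up P = upOfRecord₅C F N (θ.toStage5₁₂ F N) P) :
    IsRecordOfRecord₅C F N (datumOfRecord₅ F N (shadow₅OfRecord₁₂ F N θ h w.γ)) w :=
  isRecordOfRecord₅C_shadow F N (shadow₅OfRecord₁₂ F N θ h w.γ) (admissible_shadow₁₂ F N θ h hθ hγ) (towerOfRecord₁₂ F N θ h)
    (fun _ _ => rfl) w hC rfl hL hup

variable {F N}

/-- **REFINEMENT `IsRecordOfRecord₁₂C → IsRecordOfRecord₅C` AT THE SHADOW**: every Stage-12 record's world is a Stage-5 record at a datum with THE SAME construction,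
densities, β-functions and averaging maps. [cite: Balaban1989LargeFieldII, Thm 1 + (0.1) pp.355–356 (bookkeeping)] -/
theorem exists_isRecordOfRecord₅C_of_isRecordOfRecord₁₂C {D : FiniteEpsData F (SU N)} {w : WorldP} (h : IsRecordOfRecord₁₂C F N D w) :
    ∃ D₅ : FiniteEpsData F (SU N), IsRecordOfRecord₅C F N D₅ w ∧ D₅.C = D.C ∧ (∀ K g₀ k, D₅.dens K g₀ k = D.dens K g₀ k) ∧
      D₅.βfun = D.βfun ∧ D₅.av = D.av := by
  obtain ⟨θ, hP, hθ, rfl, hC, ⟨hγ0, -⟩, hL, hup⟩ := h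
  exact ⟨_, isRecordOfRecord₅C_shadow₁₂ F N θ hP hθ w hC hγ0 hL hup, datumOfRecord₅_shadow₁₂_C F N θ hP w.γ,
    dens_datumOfRecord₅_shadow₁₂ F N θ hP w.γ, rfl, rfl⟩

/-- **TRANSFER**: every node statement established over the Stage-5 record predicate in the `AtRecord` shape holds at every run of every Stage-12 record's world.
[cite: Balaban1989LargeFieldII, Thm 1 p.355 (bookkeeping)] -/
theorem atWorld_of_isRecordOfRecord₁₂C {X : Dag.Leaves → Prop}
    (h₅ : ∀ (D : FiniteEpsData F (SU N)) (w : WorldP), IsRecordOfRecord₅C F N D w → ∀ P : B12.RunParams, X (leavesP w P))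
    {D : FiniteEpsData F (SU N)} {w : WorldP} (h : IsRecordOfRecord₁₂C F N D w) (P : B12.RunParams) : X (leavesP w P) := by
  obtain ⟨D₅, h5, -⟩ := exists_isRecordOfRecord₅C_of_isRecordOfRecord₁₂C h
  exact h₅ D₅ w h5 P

section Transferred

variable {D : FiniteEpsData F (SU N)} {w : WorldP}

/-- Instance · GUARDED (0.20) at every Stage-12 record. [cite: Balaban1987RG1, (0.20) p.256] -/
theorem rgFlow_of_smallCouplings_of_isRecordOfRecord₁₂C (h : IsRecordOfRecord₁₂C F N D w) (P : B12.RunParams)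
    (hsc : (leavesP w P).smallCouplings) : (leavesP w P).rgFlow := by
  obtain ⟨D₅, h5, -⟩ := exists_isRecordOfRecord₅C_of_isRecordOfRecord₁₂C h
  exact rgFlow_of_smallCouplings_of_isRecordOfRecord₅C h5 P hsc

/-- Instance · N01 `Dag.B4_main` at every run of every Stage-12 record. [cite: Balaban1983RegularityDecay, Theorem p.573 (kernel version, transferred)] -/
theorem b4_main_of_isRecordOfRecord₁₂C (h : IsRecordOfRecord₁₂C F N D w) (P : B12.RunParams) : Dag.B4_main (leavesP w P) :=
  atWorld_of_isRecordOfRecord₁₂C (fun _ _ h5 P => b4_main_of_isRecordOfRecord₅C h5 P) h P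

/-- Instance · N02 `Dag.B5_main` at every run of every Stage-12 record. [cite: Balaban1984PropagatorsI, Props. 1.1–1.2 pp.33–36 (kernel versions, transferred)] -/
theorem b5_main_of_isRecordOfRecord₁₂C (h : IsRecordOfRecord₁₂C F N D w) (P : B12.RunParams) : Dag.B5_main (leavesP w P) :=
  atWorld_of_isRecordOfRecord₁₂C (fun _ _ h5 P => b5_main_of_isRecordOfRecord₅C h5 P) h P

/-- Instance · N04 `Dag.B7_main` at every run of every Stage-12 record. [cite: Balaban1985Averaging, Props. 1–10 pp.26–50 (kernel version, transferred)] -/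
theorem b7_main_of_isRecordOfRecord₁₂C (h : IsRecordOfRecord₁₂C F N D w) (P : B12.RunParams) : Dag.B7_main (leavesP w P) :=
  atWorld_of_isRecordOfRecord₁₂C (fun _ _ h5 P => b7_main_of_isRecordOfRecord₅C h5 P) h P

/-- Instance · the END headline at a Stage-12 record needs NO `rgFlow` binder. [cite: Balaban1989LargeFieldII, Thm 1 p.355 + p.391] -/
theorem endStatementBPrinted_of_isRecordOfRecord₁₂C_of_nodes (h : IsRecordOfRecord₁₂C F N D w) {γ₀ : ℝ} (hγ₀ : w.γ ≤ γ₀)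
    (hnodes : ∀ P, Nodes (leavesP w P)) (hβ : BetaBoundsInInterval w.C.toB12 γ₀ w.b w.βup) :
    B16.EndStatementBPrinted D.C := by
  obtain ⟨D₅, h5, hC5, -⟩ := exists_isRecordOfRecord₅C_of_isRecordOfRecord₁₂C h
  rw [← hC5]
  exact endStatementBPrinted_of_isRecordOfRecord₅C_of_nodes h5 hγ₀ hnodes hβ

end Transferred

/-! ## §8. The β-version faces at the Stage-12 record -/

section BetaVersion

variable {D : FiniteEpsData F (SU N)} {w : WorldP}

/-- Under the provisos, every β-input is a version of FILE 1's kernel transform AND continuous (Stage 10's face at the Stage-9 part).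
[cite: Balaban1987RG1, (0.13) p.254, (0.19) p.255 (bookkeeping)] -/
theorem betaInput_ae_eq_and_continuous₁₂ {θ : Stage12Params F N} (h : θ.Provisos₁₂ F N) {K : ℕ} (g : ℕ → ℝ) {k : ℕ} (hk : k < K) :
    ((fun V : PBond (F.P K) (k + 1) → SU N => TcOfRecord F N K k (integrand (chiFixed7 F N θ.ν K g k) (gfOfRecord F N K k) (g k)
        (effActionHT F N (TcOfRecord F N) (chiFixed7 F N θ.ν) K g k)) V) =ᵐ[piHaar (F.P K) (k + 1) (SU N)]
      (fun V => transportOfRecord F N K k (integrand (chiFixed7 F N θ.ν K g k) (gfOfRecord F N K k) (g k)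
        (effActionHT F N (TcOfRecord F N) (chiFixed7 F N θ.ν) K g k)) V)) ∧
    Continuous (fun V : PBond (F.P K) (k + 1) → SU N => TcOfRecord F N K k (integrand (chiFixed7 F N θ.ν K g k) (gfOfRecord F N K k) (g k)
        (effActionHT F N (TcOfRecord F N) (chiFixed7 F N θ.ν) K g k)) V) :=
  betaInput_ae_eq_and_continuous₁₀ h.base g hk

/-- **A STAGE-12 RECORD CERTIFIES THE β-VERSION PROVISO** and names its β. [cite: Balaban1987RG1, (1.20)–(1.22) p.264, (0.13) p.254 (bookkeeping)] -/
theorem exists_betaVersion_of_isRecordOfRecord₁₂C (h : IsRecordOfRecord₁₂C F N D w) :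
    ∃ (θ : Stage12Params F N) (hP : θ.Provisos₁₂ F N), θ.Admissible F N ∧ D = datumOfRecord₁₂ F N θ hP ∧ D.βfun = betaOfRecord₉c F N θ.toStage9Params ∧
      θ.toStage8Params.HasContTransportAlong := by
  obtain ⟨θ, hP, hθ, rfl, -⟩ := h
  exact ⟨θ, hP, hθ, rfl, rfl, hP.base.contT⟩

end BetaVersion

end Literature.MathematicalPhysics.QuantumFieldTheory.Balaban1983to89.Node00

end
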